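import Literature.MathematicalPhysics.QuantumFieldTheory.Balaban1983to89.Node00.Record13CoP

/-!
# RECORD 13 v1.6 `CoPR` — THE RUN-INDEXED RESIDUAL 𝐓-WEIGHT SLOT `Zr` (FINDING №8 ∕ LOCATED-8; director-ym LINES №169 (H1, tree-first) and №174
# (press word), 2026-08-27) — the `R` edition of the Stage-13 parameters, the run's 𝐓-weights, the form side, the core tower ∕ datum and the core record
# family (node00-def-T FILE 25)

FINDING №8 (def-T LOCATED-8; dag-ref-D GATE-(g1) = REAL first-hand, dag-ref-H READ = REAL; dag-n11-d gate (g2): the uniform instance `ZtOfRecord` does NOT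
decide it).  RECORD 12 §0's residual 𝐓-weight slot `Stage12Params.Zt : (K : ℕ) → TkResidualW Fam N (FluctV N) K` (inherited by `Stage13Params`) is indexed by
the TORUS (and the generation) ONLY, and the v1.5 weights `WtOfRecord₁₃P θ p := tkWeightsOfRecordP … p (gOfRecord₁₃ θ p) (θ.Zt p.K)` (FILE 23 §0) read it at
the run's torus `p.K`: the run `p = (K, m, g₀)` enters the 𝐓-weights through `chiA` alone.  PRINT ([III]): (1.11) p.248 «ζ(Ω₁ᶜ) is defined by all
characteristic functions and gauge fixing exponential factors localized in Ω₁ᶜ, and resummed over all admissible P₀, P′₁, Q₁»; (2.4) p.255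
`ε_j = g_j A₀(log g_j⁻²)^{p₀}`, (2.5)–(2.6) `R_j(g_j)`, the `g_j` «follow from the renormalization group equations (0.20) [I]»; (3.2)–(3.4) pp.264–265 the
decompositions of unity with `ε_k(g_k)`, `δ_k = g_k A₁∕(A₀p₀(g_k))`, gauge fixing «with V_k, ε_k, g_k instead of U, ε₀, g₀»; p.267 «for a fixed Ω_{k+1} we resum
over admissible sets P_{k+1}, Q_{k+1} … Denote the sum by ζ(Ω_{k+1})»; (3.16)–(3.21) pp.268–269.  So print's `ζ(Ω^c_{k+1})` is a functional of THE RUN's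
coupling sequence `g_j = gOfRecord₁₃ θ p j` — a function of `p.g0` and `p.m`, not of `K` alone; two runs on one torus with `g₀ ≠ g₀′` have different windows in
every factor.  The K-texts put ONE `θ` under `∃` and then `∀ P : B12.RunParams` inside the construction, so the §2 identity `TLaw₁₃CoP θ P k` is demanded against
ONE `ζ0` per torus for every run in the window (at `k = 0`: dag-n11-d's (★), an unprinted `g₀`-uniformity).  Class «record NARROWER than print in an INDEX»
(the run); a faithfulness-of-TYPE defect — no landed theorem is false, every landed file keeps compiling.

THE FIX (director-ym №169 H1 verbatim, №174 order (1); ONE edition, CLASS-level, new leaves only — nothing landed is edited): a new parameters layer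
`structure Stage13RParams extends Stage13Params` with ONE new field `Zr : (p : B12.RunParams) → TkResidualW Fam N (FluctV N) p.K` (12a's `TkResidualW`
untouched), the run's weights `WtOfRecord₁₃R θ p := tkWeightsOfRecordP … p (gOfRecord₁₃ θ.toStage13Params p) (θ.Zr p)`, the proviso rows `zrLaws ∕ zrLocal`
(12a's `Laws` ∕ 12b's `LocalLaws` of `θ.Zr p`, per run), the named guard `Stage13RParams.ZrUnity` (never a proviso), and EVERYTHING downstream of the weights
re-issued under ONE new suffix by the generator of record.  The old slot `Zt` STAYS a field (of `Stage12Params`) that NOTHING of the `R` edition reads except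
through the run-blind embedding of §R1.  No numeral and no law is pinned: `Zr` is a parameter, its laws are DISPLAYED proviso rows, print's partition of unity
is a NAMED guard — exactly the 12a ∕ 12b discipline.

THIS MODULE is the VERBATIM image of the landed v1.5 FILE 23 `Node00/Record13CoP.lean` (and of v1.2's two `Provisos₁₃Core` units FILE 23 cites) under ONE
uniform token rule KEY-RULE-25 (= KEY-RULE-23 with the edition token `CoPR`):
* (binder) `θ : Stage13Params F N ↦ θ : Stage13RParams F N`; dotted declarations move to the namespace `Stage13RParams.` (`Stage13RParams.Provisos₁₃CoPR`
  (+ `.wtLaws`, `.tstep`), `Stage13RParams.toStage5₁₃CoPR` (+ `_res_…`); FILE 26T: `Stage13RParams.Provisos₁₃SepCoPR` …);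
* (seed — semantic) `WtOfRecord₁₃P θ p ↦ WtOfRecord₁₃R θ p` (the run-indexed slot `θ.Zr p` for `θ.Zt p.K`), `WtOfRecord₁₃P_laws ↦ WtOfRecord₁₃R_laws`
  (`hZ : ∀ p, (θ.Zr p).Laws`), v1.2's bg-free core `Stage13Params.Provisos₁₃Core ↦ Stage13RParams.Provisos₁₃CoPR` (same rows, same order, `ztLaws ∕ ztLocal ↦
  zrLaws ∕ zrLocal`), `.wtLawsP ↦ .wtLaws`, guard `Stage12Params.ZtUnity ↦ Stage13RParams.ZrUnity`;
* (names) the edition token of every imaged name `CoP ↦ CoPR` (`S218OfRecord₁₃CoPR`, `ScorrLawOfRecord₁₃CoPR`, `SLaw₁₃CoPR ∕ TLaw₁₃CoPR` (+ `_iff`, `_zero`,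
  `s218OfRecord₁₃CoPR_zero_iff`, `sLaw₁₃CoPR_of_forall_slot_eq_zero`), `VOfRecord₁₃CoPR` (+ faces), `residualOfStage13CoPR`, `Stage13RParams.toStage5₁₃CoPR`,
  `rOperation_upOfRecord₅C_stage13CoPR_iff`, `coreOfRecord₁₃CoPR` (+ faces), `towerOfRecord₁₃CoPR`, `datumOfRecord₁₃CoPR` (+ faces), `IsRecordOfRecord₁₃CCoPR`
  (+ pointed ∕ existential faces, consequences), `shadowResidual₁₃CoPR ∕ shadow₅OfRecord₁₃CoPR` (+ faces), `endStatementBPrinted_of_isRecordOfRecord₁₃CCoPR_of_nodes`,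
  `actionSide_stage13CoPR`, `effAction_succ_stage13CoPR`, `exists_beta_of_isRecordOfRecord₁₃CCoPR`, …);
* (SITE-RULE) at the explicit sites of every function NOT re-issued the parameter is passed as `θ.toStage13Params` (`gOfRecord₁₃`, `EOfRecord₁₃`, `densOfRecord₁₃`,
  `tdensOfRecord₁₃`, `betaOfRecord₁₃`, `settingOfRecord₁₃`, `chiβOfRecord₁₃`, `reprOfRecord₁₃ ∕ reprTOfRecord₁₃`, `UbgOfRecord₁₃CoP`, `PartCompat₁₃`,
  `suppOfRecord₁₃SepCoP`, `holds_densOfRecord₁₃`, `integral_densOfRecord₁₃_succ`, …; the ancestor views `θ.toStage9Params ∕ θ.toStage8Params ∕ θ.toStage5Params`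
  and the inherited fields `θ.ν`, `θ.τ9`, `θ.A₁`, `θ.ζ`, `θ.ppSel`, `θ.Rz`, `θ.εbg`, `θ.γ`, `θ.L`, … are unchanged) — house style, as `θ.toStage9Params` in v1.2.
Every statement SHAPE and binder list is preserved token for token (HYP-AUDIT: nothing dropped, weakened or added; proofs re-checked, no `sorry`; no
instance, no notation, no attribute; nothing landed is edited).
NOT re-issued (they do not read the residual 𝐓-weight slot; cited at `θ.toStage13Params`): `Stage13Params` itself and every Stage-≤13 field ∕ row lemma,
`gOfRecord₁₃`, `EOfRecord₁₃`, `densOfRecord₁₃ ∕ tdensOfRecord₁₃` (12a-free and background-free, DATUM NOTE of FILE 23), `settingOfRecord₁₃`, `betaOfRecord₁₃`,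
`chiβOfRecord₁₃`, the background `UbgOfRecord₁₃CoP` (+ `_zero ∕ _succ`), the supports `suppOfRecord₁₃P ∕ suppOfRecord₁₃SepP ∕ suppOfRecord₁₃SepCoP` and their
lemmas, `avOfRecord`.  The v1.5 `CoP` objects of FILE 23 ∕ 24T stay in the tree (settled helper files of their consumers stand).

PLAN Q1 (IMPACT-169): NO declaration of this module or of FILE 26T reads `θ.Zt` — except THROUGH the run-blind embedding `Stage13RParams.ofRunBlind θ :=
⟨θ, fun p => θ.Zt p.K⟩` (§R1; plan Q4), the one door by which the v1.5 record enters the `R` edition: at it the run's weights, the core, the Stage-5 view and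
the datum ARE the v1.5 ones (`rfl`: `WtOfRecord₁₃R_ofRunBlind`, `coreOfRecord₁₃CoPR_ofRunBlind`, `Stage13RParams.toStage5₁₃CoPR_ofRunBlind`,
`datumOfRecord₁₃CoPR_ofRunBlind`), v1.2's `Provisos₁₃Core` GIVES `Provisos₁₃CoPR` (`Stage13Params.Provisos₁₃Core.ofRunBlind`), 12b's `ZtUnity` GIVES `ZrUnity`
(`Stage12Params.ZtUnity.ofRunBlind`), admissibility and `SlotsNondegenerate₁₃` are read through `toStage13Params` (`Iff.rfl`), and every v1.5 core record IS
a v1.6 core record (`IsRecordOfRecord₁₃CCoPR.ofCoP`).  ONE-WAY: a v1.6 parameter need not be run-blind — that is the point of FINDING №8.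
WATCH-RZ (dag-ref-H): `Stage12Params.Rz : (K : ℕ) → Sect2.Residual …` is torus-indexed too; NOT opened here (director-ym №176: the v1.6 scope is `Zr` ONLY;
no consumer has located a run-dependence of print's §2 remainders that it reads).

LAYOUT.  §0 (R) — `Stage13RParams` (`extends Stage13Params`, field `Zr`), `Stage13RParams.ZrUnity`, `WtOfRecord₁₃R` (+ `_laws`), `Stage13RParams.Provisos₁₃CoPR`
(+ `.wtLaws`, `.tstep`).  §1 (R) `FormSideCoPR` — `S218OfRecord₁₃CoPR`, `ScorrLawOfRecord₁₃CoPR`, `SLaw₁₃CoPR ∕ TLaw₁₃CoPR` (+ `_iff`, `_zero`, …),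
`VOfRecord₁₃CoPR` (+ faces), `residualOfStage13CoPR`, `Stage13RParams.toStage5₁₃CoPR` (+ `_res_…`), `rOperation_upOfRecord₅C_stage13CoPR_iff`,
`coreOfRecord₁₃CoPR` (+ faces).  §2 (R) `CoreTowerCoPR` — `towerOfRecord₁₃CoPR`, `datumOfRecord₁₃CoPR` and their `rfl` faces.  §3 (R) `CoreRecordCoPR` — the
core-keyed face family at the `R` datum (the [V] Thm 1 induction sockets, `IsRecordOfRecord₁₃CCoPR` with its pointed ∕ existential faces and consequences,
the Stage-5 shadow, the node sockets, the β-layer faces).  §R1 `RunBlindCoPR` — the run-blind embedding `Stage13RParams.ofRunBlind` and its `rfl` ∕ one-way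
bridges (P3′ of record).

HONEST FRAMING.  Definitions and verbatim-imaged bookkeeping of record — a typing-faithfulness repair of a CONDITIONAL record; NOTHING of Bałaban is
asserted ([15] Thm 1, (2.27)(iv), hypothesis (B), [V] Thm 1 remain hypotheses ∕ sockets exactly as in v1.2 ∕ FILE 21 ∕ FILE 23); dag-n11-d's (★) is
neither asserted nor refuted here; the node item K0 is NOT discharged by this file (pub-ymgap-plan rev 22 re-keys K0–K3 ONCE on these names, director-ym
№174 (2)); counts UNMOVED (typed 28∕28 · discharged 5∕28); one finite 𝕋⁴ programme at fixed ε — NOT the continuum ∕ ℝ⁴ ∕ OS ∕ mass-gap ∕ Clay statement.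
References: [III] = Balaban1988Convergent, [6] = Balaban1985RegularSpaces, [15] = Balaban1985Variational, [IV] = Balaban1989LargeFieldI, [V] =
Balaban1989LargeFieldII, [B8] = Balaban1987RG1.
-/

noncomputable section

open MeasureTheory
open scoped Matrix.Norms.L2Operator

namespace Literature.MathematicalPhysics.QuantumFieldTheory.Balaban1983to89.Node00

open T4Continuum AveragingRT T4FiniteEpsInhabited FlowStep FlowStepRuns DagBinding T4DatumAssembly
open B12Eq019ActionBody (integrand)

variable (F : T4Family) (N : ℕ) [NeZero N]

/-! ## §0 (R). THE STAGE-13 PARAMETERS WITH THE RUN-INDEXED RESIDUAL 𝐓-WEIGHT SLOT (v1.6; FINDING №8 ∕ director-ym LINE №169 H1): `Stage13RParams`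
(`extends Stage13Params`, ONE new field `Zr`), the named guard `ZrUnity`, the 𝐓-weights of the run `WtOfRecord₁₃R` (+ `_laws`), and the bg-free proviso
core `Stage13RParams.Provisos₁₃CoPR` (v1.2's `Provisos₁₃Core` with rows `ztLaws ∕ ztLocal ↦ zrLaws ∕ zrLocal`) with `.wtLaws`, `.tstep` -/

/-- **STAGE-13 PARAMETERS WITH THE RUN-INDEXED RESIDUAL 𝐓-WEIGHT SLOT** (v1.6 `R` = RECORD 13 v1.5 `CoP` + FINDING №8; director-ym LINE №169 H1 verbatim):
the Stage-13 parameters `Stage13Params` (RECORD 13 §0, reused VERBATIM through `toStage13Params`: the numerics `ν`, `τ9`, the β-dictionary, `A₁`, the §2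
numerics `s2`, the residual data `Rz`, `ζ`, the selector `ppSel`, the (2.9) threshold `ε₂₉`, … and 12a's RUN-BLIND slot `Zt : (K : ℕ) → TkResidualW … K`,
which STAYS a field that NOTHING of this edition reads) EXTENDED by ONE residual object: the RUN-INDEXED residual part `Zr p : TkResidualW Fam N (FluctV N) p.K`
(`ζ0`, `quad` — 12a's `TkResidualW`, untouched) of the 𝐓-weights of the run `p = (K, m, g₀)`.  Print's `ζ(Ω^c_{k+1})` ([III] (1.11) p.248 «resummed over all
admissible P₀, P′₁, Q₁», (2.4) p.255, (3.16)–(3.20) pp.268–269) is the resummation of the (3.2)·(3.3) characteristic functions OF THE RUN's own sequence of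
small-field restrictions, whose thresholds `ε_j = ε(g_j)` run along THIS run's history `g_j = gOfRecord₁₃ θ p j` — a function of `p.g0` and `p.m`, not of
`K` alone; a `K`-indexed slot cannot hold it (def-T LOCATED-8: «record NARROWER than print in an INDEX»; probe P1–P4, not filed).  No numeral and no law is
pinned here: the laws of `Zr` are the DISPLAYED rows `zrLaws ∕ zrLocal` of `Provisos₁₃CoPR` (below) and of `Provisos₁₃SepCoPR` (FILE 26T), and print's
partition-of-unity identity is the NAMED guard `ZrUnity` (never a proviso, exactly as 12b's `ZtUnity`).  Structure-instance re-keying of every consumer is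
`θ ↦ θ.toStage13Params` at the explicit sites of the functions NOT re-issued (house style, as `θ.toStage9Params`).
[cite: Balaban1988Convergent, (1.11) p.248, (2.4) p.255, (2.21) p.258, (3.2)–(3.3) p.265, (3.16)–(3.20) pp.268–269, p.267] -/
structure Stage13RParams (Fam : T4Family) (N : ℕ) [NeZero N] extends Stage13Params Fam N where
  /-- the RUN-INDEXED residual part (`ζ0`, `quad`) of the 𝐓-weights of the run `p`: print's `ζ(Ω^c_{k+1})` of THIS run's sequence of restrictions
  ([III] (1.11) p.248, (3.16)–(3.20) pp.268–269; FINDING №8) -/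
  Zr : (p : B12.RunParams) → TkResidualW Fam N (FluctV N) p.K

/-- **PRINT'S PARTITION OF UNITY OF THE RUN'S RESIDUAL FACTOR, NAMED** (v1.6 `R`; NOT a proviso — 12b's `Stage12Params.ZtUnity` VERBATIM with the run-blind
slot `θ.Zt K` replaced by the run-indexed slot `θ.Zr p`; director LINE №92 (2) typing directive, LINE №169 H1 «guard `ZrUnity`»): `Σ_Y ζ0 j Y ω = 1` for
every run, generation and configuration (the `ζ_j(R, S)` of (3.16)–(3.20) sum to one over the admissible large-field assignments).  Records with `Zr = 0`
(admissible: every §2 slot at `k ≥ 1` then vanishes, dag-ref-H (S3)) violate it; a consumer needing non-degenerate 𝐓-weights hypothesises `θ.ZrUnity`.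
[cite: Balaban1988Convergent, (3.16)–(3.20) pp.268–269] -/
def Stage13RParams.ZrUnity (θ : Stage13RParams F N) : Prop :=
  ∀ (p : B12.RunParams) (j : ℕ) (ω : Tk.MultiCfg (F.P p.K) (SU N) (FluctV N)), (∑ᶠ Y : Set (Site (F.P p.K) 0), (θ.Zr p).ζ0 j Y ω) = 1

/-- **THE 𝐓-WEIGHTS OF RECORD OF THE RUN `p`, Stage 13, OVER THE RUN-INDEXED RESIDUAL** (v1.6; director-ym LINE №169 (1) verbatim): 12a″'s `tkWeightsOfRecordP`
(print's `ζ`, no χreg factor) along the ₁₃ history of the run over THE RUN's residual part `θ.Zr p` — print's `ζ(Ω^c_{k+1})` is resummed over the admissible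
restrictions OF THIS RUN ([III] (1.11) p.248, (2.4) p.255, (3.16)–(3.20) pp.268–269), whose small-field thresholds `ε(g_j)` run along `g_j = gOfRecord₁₃ θ p j`
(a function of `p.g0` and `p.m`, not of `K` alone).  The v1.5 weights `WtOfRecord₁₃P θ.toStage13Params p` are the RUN-BLIND SPECIAL CASE `Zr := fun p => θ.Zt p.K`
(by `rfl`; def-T probe, not filed). [cite: Balaban1988Convergent, (1.11) p.248, (2.4) p.255, (2.21) p.258, (3.16) p.268, (3.21) p.269, (3.3) p.265] -/
def WtOfRecord₁₃R (θ : Stage13RParams F N) (p : B12.RunParams) : TkWeights F N (FluctV N) p.K :=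
  tkWeightsOfRecordP F N (FluctV N) θ.ν θ.A₁ p (gOfRecord₁₃ F N θ.toStage13Params p) (θ.Zr p)

variable {F N} in
/-- 11a's weight laws hold for the run's Stage-13 weights of record under the run-indexed residual law `∀ p, (θ.Zr p).Laws`. [cite: Balaban1988Convergent, (2.21) p.258] -/
theorem WtOfRecord₁₃R_laws {θ : Stage13RParams F N} (hZ : ∀ p, (θ.Zr p).Laws) (p : B12.RunParams) : (WtOfRecord₁₃R F N θ p).Laws :=
  tkWeightsOfRecordP_laws (hZ p)

/-- **THE bg-FREE CORE OF THE DISPLAYED PROVISOS, Stage 13, OVER THE RUN-INDEXED RESIDUAL 𝐓-WEIGHT SLOT** (v1.6 `R`; director-ym LINE №169 H1, FINDING №8):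
v1.2's `Stage13Params.Provisos₁₃Core` (`Node00/Record13.lean` §9) VERBATIM — same rows, same order: `intPiece`, `measω`, `measChi`, `zetaUnity`, `zetaAbs`, `rstep`,
`rzLaws` — except that 12a's two rows on the RUN-BLIND slot, `ztLaws : ∀ K, (θ.Zt K).Laws` and `ztLocal : ∀ K, (θ.Zt K).LocalLaws`, are REPLACED by the same two laws
of the RUN-INDEXED slot, `zrLaws : ∀ p, (θ.Zr p).Laws` and `zrLocal : ∀ p, (θ.Zr p).LocalLaws` (12a's `TkResidualW.Laws` ∕ 12b's `TkResidualW.LocalLaws`, untouched).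
NO row of this structure reads `θ.Zt` (the run-blind slot stays a field of `Stage12Params` that nothing of the `R` edition reads).  Exactly the rows the tower ∕ datum ∕
shadow of record READ (`tstep`, `rstep`; the laws); the separated-range provisos `Provisos₁₃SepCoPR` (FILE 26T) project to it (`.toCore`).  Rows `intPiece` ∕ `measω` ∕
`measChi` ∕ `rstep` remain THEOREMS of (H-U) and the ζ-laws at `θ.toStage13Params` (RECORD 13 §4c, unchanged).  HYPOTHESES, never admissibility clauses, never asserted.
[cite: Balaban1988Convergent, (2.7) p.255, (2.18) p.257, (2.21) p.258, (3.2)–(3.9) pp.265–266, (3.16) p.268, (3.20)–(3.21) p.269, p.267; Balaban1989LargeFieldI, (0.3)–(0.4) p.176; Balaban1987RG1, (0.13) p.254, (0.19) p.255] -/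
structure Stage13RParams.Provisos₁₃CoPR (θ : Stage13RParams F N) : Prop where
  /-- the level-`k` pieces `χ_k(s)·slot_k(s)` of `ρ_k` are integrable, `k < K`, along the ₁₃ histories -/
  intPiece : ∀ (p : B12.RunParams) (k : ℕ), k < p.K → ∀ s : SeqOfRecord F θ.ν θ.τ9.M (gOfRecord₁₃ F N θ.toStage13Params p) p.K k,
    Integrable (fun U => chiSeqOfRecord F N θ.ν θ.τ9.M (gOfRecord₁₃ F N θ.toStage13Params p) p.K k s U *
      slotsOfRecord F N θ.ν θ.τ9 (EOfRecord₁₃ F N θ.toStage13Params) (wOfRecord₉ F N θ.toStage9Params) θ.ppSel p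
        (gOfRecord₁₃ F N θ.toStage13Params p) k s U) (fieldMeasure (F.P p.K) k (SU N))
  /-- (O4): the label weights `ω = a·b·ζ` are jointly measurable in `(V′, U)`, `k < K`, along the ₁₃ histories -/
  measω : ∀ (p : B12.RunParams) (k : ℕ), k < p.K → ∀ (s : SeqOfRecord F θ.ν θ.τ9.M (gOfRecord₁₃ F N θ.toStage13Params p) p.K k)
    (t : LbOfRecord F θ.ν p (gOfRecord₁₃ F N θ.toStage13Params p) k),
    Measurable (fun z : GaugeField (F.P p.K) (k + 1) (SU N) × GaugeField (F.P p.K) k (SU N) =>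
      ωOfRecord F N θ.ν θ.τ9.M p (gOfRecord₁₃ F N θ.toStage13Params p) k θ.A₁ θ.ζ s t z.2 z.1)
  /-- the new front factors `χ_{k+1}(s′)` are measurable, `k < K`, along the ₁₃ histories -/
  measChi : ∀ (p : B12.RunParams) (k : ℕ), k < p.K → ∀ s' : SeqOfRecord F θ.ν θ.τ9.M (gOfRecord₁₃ F N θ.toStage13Params p) p.K (k + 1),
    Measurable (chiSeqOfRecord F N θ.ν θ.τ9.M (gOfRecord₁₃ F N θ.toStage13Params p) p.K (k + 1) s')
  /-- the residual `ζ` resolves unity -/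
  zetaUnity : IsZetaUnity F N θ.ν θ.τ9.M θ.ζ
  /-- the residual `ζ` has `Σ |ζ| ≤ 1` -/
  zetaAbs : IsZetaAbsLeOne F N θ.ν θ.τ9.M θ.ζ
  /-- def-R's (0.3) provisos of the pre-𝐑 tower of record, INTEGRABLE FORM (`RepData.ProvisosInt`), at every level `k+1 ≤ K`, along the ₁₃ histories, at
  every instance -/
  rstep : ∀ (p : B12.RunParams) (k : ℕ) [DecidableEq (PBond (F.P p.K) (k + 1))], k < p.K →
    (towerRepOfRecord F N θ.ν θ.τ9 (slotsTOfRecord F N θ.ν θ.τ9 (EOfRecord₁₃ F N θ.toStage13Params) (wOfRecord₉ F N θ.toStage9Params) θ.ppSel)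
      θ.ppSel p (gOfRecord₁₃ F N θ.toStage13Params p) (k + 1)).toRepData.ProvisosInt
  /-- 11c's laws of the residual §2 data -/
  rzLaws : ∀ K, (θ.Rz K).Laws
  /-- (v1.6 · RUN-INDEXED, FINDING №8) 12a's law of the residual part of the 𝐓-weights OF THE RUN: `ζ0 ≥ 0` -/
  zrLaws : ∀ p, (θ.Zr p).Laws
  /-- (v1.6 · RUN-INDEXED) the locality law of the residual 𝐓-weight factor OF THE RUN -/
  zrLocal : ∀ p, (θ.Zr p).LocalLaws
  /-- **(H-ζ) ROW** (v1.8 · director-ym №228 LOCATED-ζ · plan g87 S2-FULL): the residual fluctuation factor `ζ` of the record is jointly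
  measurable in the old and new fields — the displayed bookkeeping proviso `ZetaMeasurable` (RECORD 12 measurability), until v1.7 threaded
  as a separate hypothesis `hζ`, now a ROW of every Stage-13 proviso edition.  A REAL, REQUIRED field (readers: `h.zetaMeas`); the `autoParam`
  default below only FILLS it at a construction site that omits it — from a Stage-13 proviso value of ANY edition already in hand (the
  transports ∕ doors) or from an `hζ` in context (the from-scratch selectors) — and fails loudly with the goal displayed otherwise.
  HYPOTHESIS, never an admissibility clause, never asserted. [cite: Balaban1988Convergent, (3.16) p.268, (3.20)–(3.21) p.269 (bookkeeping)] -/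
  zetaMeas : ZetaMeasurable F N θ.ζ := by
    first
      | (have h' := ‹_root_.Literature.MathematicalPhysics.QuantumFieldTheory.Balaban1983to89.Node00.Stage13Params.Provisos₁₃ _ _ _›; exact h'.zetaMeas)
      | (have h' := ‹_root_.Literature.MathematicalPhysics.QuantumFieldTheory.Balaban1983to89.Node00.Stage13Params.Provisos₁₃Core _ _ _›; exact h'.zetaMeas)
      | (have h' := ‹_root_.Literature.MathematicalPhysics.QuantumFieldTheory.Balaban1983to89.Node00.Stage13Params.Provisos₁₃Sep _ _ _›; exact h'.zetaMeas)
      | (have h' := ‹_root_.Literature.MathematicalPhysics.QuantumFieldTheory.Balaban1983to89.Node00.Stage13Params.Provisos₁₃SepCo _ _ _›; exact h'.zetaMeas)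
      | (have h' := ‹_root_.Literature.MathematicalPhysics.QuantumFieldTheory.Balaban1983to89.Node00.Stage13Params.Provisos₁₃SepMixed _ _ _›; exact h'.zetaMeas)
      | (have h' := ‹_root_.Literature.MathematicalPhysics.QuantumFieldTheory.Balaban1983to89.Node00.Stage13Params.Provisos₁₃SepCoP _ _ _›; exact h'.zetaMeas)
      | (have h' := ‹_root_.Literature.MathematicalPhysics.QuantumFieldTheory.Balaban1983to89.Node00.Stage13RParams.Provisos₁₃CoPR _ _ _›; exact h'.zetaMeas)
      | (have h' := ‹_root_.Literature.MathematicalPhysics.QuantumFieldTheory.Balaban1983to89.Node00.Stage13RParams.Provisos₁₃SepCoPR _ _ _›; exact h'.zetaMeas)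
      | (have h' := ‹_root_.Literature.MathematicalPhysics.QuantumFieldTheory.Balaban1983to89.Node00.Stage13HParams.Provisos₁₃CoPH _ _ _›; exact h'.zetaMeas)
      | (have h' := ‹_root_.Literature.MathematicalPhysics.QuantumFieldTheory.Balaban1983to89.Node00.Stage13HParams.Provisos₁₃SepCoPH _ _ _›; exact h'.zetaMeas)
      | assumption

variable {F N}

/-- The weight laws of the run FROM the core (row `zrLaws`). [cite: Balaban1988Convergent, (2.21) p.258 (bookkeeping)] -/
theorem Stage13RParams.Provisos₁₃CoPR.wtLaws {θ : Stage13RParams F N} (h : θ.Provisos₁₃CoPR F N) (p : B12.RunParams) : (WtOfRecord₁₃R F N θ p).Laws :=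
  WtOfRecord₁₃R_laws h.zrLaws p

/-- **def-T's step provisos FROM the core** at every step `k < K` (v1.2's `Provisos₁₃Core.tstep` verbatim at `θ.toStage13Params`; the step provisos do not read the residual 𝐓-weight slot). [cite: Balaban1988Convergent, (3.2)–(3.9) pp.265–266, (3.16) p.268, (3.24)–(3.25) p.270] -/
theorem Stage13RParams.Provisos₁₃CoPR.tstep {θ : Stage13RParams F N} (h : θ.Provisos₁₃CoPR F N) (p : B12.RunParams) (k : ℕ) (hk : k < p.K) :
    TStepProvisos F N θ.ν θ.τ9 (EOfRecord₁₃ F N θ.toStage13Params) (wOfRecord₉ F N θ.toStage9Params) θ.ppSel p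
      (gOfRecord₁₃ F N θ.toStage13Params p) k where
  intPiece := h.intPiece p k hk
  measW := fun s' => measurable_wOfRecord F N θ.ν θ.τ9.M θ.A₁ θ.ζ p (gOfRecord₁₃ F N θ.toStage13Params p) k (h.measω p k hk) s'
  absW_le := fun s' U V' => abs_wOfRecord_le_one F N θ.ν θ.τ9.M θ.A₁ h.zetaAbs p (gOfRecord₁₃ F N θ.toStage13Params p) k s' U V'
  measChi := h.measChi p k hk
  unity := isStepUnity_wOfRecord F N θ.ν θ.τ9.M θ.A₁ h.zetaUnity p (gOfRecord₁₃ F N θ.toStage13Params p) k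

variable (F N)

/-! ## §1 (R). THE FORM SIDE OF RECORD 13 OVER THE RUN'S 𝐓-WEIGHTS `WtOfRecord₁₃R`: the (2.18) form `S218OfRecord₁₃CoPR`, the laws 𝐒 ∕ 𝐓 (`SLaw₁₃CoPR ∕ TLaw₁₃CoPR`),
the 𝐑-carriers `VOfRecord₁₃CoPR`, the residual, the Stage-5 view `Stage13RParams.toStage5₁₃CoPR`, the core `coreOfRecord₁₃CoPR` — every v1.5 statement of FILE 23 §1 VERBATIM under
KEY-RULE-25 (the background `UbgOfRecord₁₃CoP` and the supports are CITED from FILE 23 at `θ.toStage13Params`: they do not read the residual 𝐓-weight slot) -/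

section FormSideCoPR

/-- **THE §2 [III] FORMAT PREDICATE OF RECORD, Stage 13** for step-`j` densities of the run `p`: represented by `rep_j` of record AND the post-𝐑 slot family of record
has the REPAIRED §2 form at index `j` — at the ₁₃ setting, weights, background maps and slots. [cite: Balaban1988Convergent, (2.17)–(2.18) p.257, (2.23)–(2.42) pp.258–261, Thm 1 p.262] -/
def S218OfRecord₁₃CoPR (θ : Stage13RParams F N) (p : B12.RunParams) (j : ℕ) (σ : Density (F.P p.K) j (SU N)) : Prop :=
  (reprOfRecord₁₃ F N θ.toStage13Params p j).Holds σ ∧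
    HasSect2FormAEZ F N (FluctV N) p.K (settingOfRecord₁₃ F N θ.toStage13Params p) (θ.Rz p.K) (WtOfRecord₁₃R F N θ p) j
      (UbgOfRecord₁₃CoP F N θ.toStage13Params p j)
      (slotsOfRecord F N θ.ν θ.τ9 (EOfRecord₁₃ F N θ.toStage13Params) (wOfRecord₉ F N θ.toStage9Params) θ.ppSel p
        (gOfRecord₁₃ F N θ.toStage13Params p) j)

/-- **THE «CORRESPONDING SPACE» PREDICATE OF RECORD, Stage 13** for the 𝐓-image at step `k+1`. [cite: Balaban1988Convergent, remark p.262, Def. p.279, (3.25) p.270] -/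
def ScorrLawOfRecord₁₃CoPR (θ : Stage13RParams F N) (p : B12.RunParams) (k : ℕ) (σ' : Density (F.P p.K) (k + 1) (SU N)) : Prop :=
  (reprTOfRecord₁₃ F N θ.toStage13Params p k).Holds σ' ∧
    HasSect2FormTAEZ F N (FluctV N) p.K (settingOfRecord₁₃ F N θ.toStage13Params p) (θ.Rz p.K) (WtOfRecord₁₃R F N θ p) k
      (UbgOfRecord₁₃CoP F N θ.toStage13Params p (k + 1))
      (slotsTOfRecord F N θ.ν θ.τ9 (EOfRecord₁₃ F N θ.toStage13Params) (wOfRecord₉ F N θ.toStage9Params) θ.ppSel p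
        (gOfRecord₁₃ F N θ.toStage13Params p) (k + 1))

/-- **`SLaw₁₃CoPR θ p j`** — `S218OfRecord₁₃CoPR` READ AT `densOfRecord₁₃`. [cite: Balaban1988Convergent, (2.18) p.257, Thm 1 p.262] -/
def SLaw₁₃CoPR (θ : Stage13RParams F N) (p : B12.RunParams) (j : ℕ) : Prop :=
  S218OfRecord₁₃CoPR F N θ p j (densOfRecord₁₃ F N θ.toStage13Params p j)

/-- **`TLaw₁₃CoPR θ p k`** — `ScorrLawOfRecord₁₃CoPR` READ AT `tdensOfRecord₁₃`. [cite: Balaban1988Convergent, remark p.262, Def. p.279] -/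
def TLaw₁₃CoPR (θ : Stage13RParams F N) (p : B12.RunParams) (k : ℕ) : Prop :=
  ScorrLawOfRecord₁₃CoPR F N θ p k (tdensOfRecord₁₃ F N θ.toStage13Params p k)

/-- `SLaw₁₃CoPR` IS the repaired §2 form of the post-𝐑 slot family (the representation clause holds by construction). [cite: Balaban1988Convergent, (2.18) p.257, Thm 1 p.262] -/
theorem sLaw₁₃CoPR_iff (θ : Stage13RParams F N) (p : B12.RunParams) (j : ℕ) :
    SLaw₁₃CoPR F N θ p j ↔ HasSect2FormAEZ F N (FluctV N) p.K (settingOfRecord₁₃ F N θ.toStage13Params p) (θ.Rz p.K) (WtOfRecord₁₃R F N θ p) j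
      (UbgOfRecord₁₃CoP F N θ.toStage13Params p j)
      (slotsOfRecord F N θ.ν θ.τ9 (EOfRecord₁₃ F N θ.toStage13Params) (wOfRecord₉ F N θ.toStage9Params) θ.ppSel p
        (gOfRecord₁₃ F N θ.toStage13Params p) j) :=
  ⟨fun h => h.2, fun h => ⟨holds_densOfRecord₁₃ F N θ.toStage13Params p j, h⟩⟩

/-- `TLaw₁₃CoPR` IS the repaired 𝐓-image form of the pre-𝐑 slot family. [cite: Balaban1988Convergent, remark p.262, (3.25) p.270] -/
theorem tLaw₁₃CoPR_iff (θ : Stage13RParams F N) (p : B12.RunParams) (k : ℕ) :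
    TLaw₁₃CoPR F N θ p k ↔ HasSect2FormTAEZ F N (FluctV N) p.K (settingOfRecord₁₃ F N θ.toStage13Params p) (θ.Rz p.K) (WtOfRecord₁₃R F N θ p) k
      (UbgOfRecord₁₃CoP F N θ.toStage13Params p (k + 1))
      (slotsTOfRecord F N θ.ν θ.τ9 (EOfRecord₁₃ F N θ.toStage13Params) (wOfRecord₉ F N θ.toStage9Params) θ.ppSel p
        (gOfRecord₁₃ F N θ.toStage13Params p) (k + 1)) :=
  ⟨fun h => h.2, fun h => ⟨holds_tdensOfRecord₁₃ F N θ.toStage13Params p k, h⟩⟩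

/-- **THE BASE IS A THEOREM** at Stage 13: the level-0 post-𝐑 slot family HAS the repaired §2 form for EVERY `θ` and run — n13-e's GENERIC
`hasSect2FormAE_zero_of_bg_readsScaleZero` (any setting whose flow starts at `g 0`, any background map reading the scale-0 variables), identity branch.
[cite: Balaban1988Convergent, Thm 1 p.262, (2.18) p.257, (2.23)–(2.24) pp.258–259] -/
theorem sLaw₁₃CoPR_zero (θ : Stage13RParams F N) (p : B12.RunParams) : SLaw₁₃CoPR F N θ p 0 :=
  (sLaw₁₃CoPR_iff F N θ p 0).mpr
    (B16Thm1BaseAtRecord11.hasSect2FormAE_zero_of_bg_readsScaleZero F N (FluctV N) p (settingOfRecord₁₃ F N θ.toStage13Params p) (θ.Rz p.K)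
      (WtOfRecord₁₃R F N θ p) θ.ν θ.τ9 (EOfRecord₁₃ F N θ.toStage13Params) (wOfRecord₉ F N θ.toStage9Params) θ.ppSel rfl
      (U := UbgOfRecord₁₃CoP F N θ.toStage13Params p 0) (fun _ _ => rfl)).toZ

/-- … so at level 0 the format predicate of record IS the representation clause. [cite: Balaban1988Convergent, Thm 1 p.262, (2.18) p.257 (bookkeeping)] -/
theorem s218OfRecord₁₃CoPR_zero_iff (θ : Stage13RParams F N) (p : B12.RunParams) (σ : Density (F.P p.K) 0 (SU N)) :
    S218OfRecord₁₃CoPR F N θ p 0 σ ↔ (reprOfRecord₁₃ F N θ.toStage13Params p 0).Holds σ :=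
  ⟨fun h => h.1, fun h => ⟨h, (sLaw₁₃CoPR_zero F N θ p).2⟩⟩

/-- **ABSENT SLOTS PASS**: if every post-𝐑 slot of record at level `j` is the zero function, `SLaw₁₃CoPR θ p j` holds under the signs `0 ≤ E₀, B₀` and a nonnegative
history up to `j`. [cite: Balaban1988Convergent, (2.17) p.257; Balaban1987RG1, (0.20) p.256] -/
theorem sLaw₁₃CoPR_of_forall_slot_eq_zero (θ : Stage13RParams F N) (p : B12.RunParams) (j : ℕ)
    (h0 : ∀ s, slotsOfRecord F N θ.ν θ.τ9 (EOfRecord₁₃ F N θ.toStage13Params) (wOfRecord₉ F N θ.toStage9Params) θ.ppSel p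
      (gOfRecord₁₃ F N θ.toStage13Params p) j s = 0)
    (hE₀ : 0 ≤ θ.s2.lf.E₀) (hB₀ : 0 ≤ θ.s2.lf.B₀) (hg : ∀ i, i ≤ j → 0 ≤ gOfRecord₁₃ F N θ.toStage13Params p i) : SLaw₁₃CoPR F N θ p j :=
  (sLaw₁₃CoPR_iff F N θ p j).mpr
    (hasSect2FormAEZ_of_forall_eq_zero p.K _ _ _ j _ h0 (settingOfRecord₁₃_satisfiesRG F N θ.toStage13Params p j) hE₀ hB₀ hg)

/-- **THE 𝐑-CARRIERS OF THE RUN `p`, Stage 13**: target space `S j ρ :↔ ρ = ρ_j ∧ SLaw₁₃CoPR θ p j`, corresponding space `Scorr (k+1) ρ' :↔ ρ' = 𝐓ρ_k ∧ TLaw₁₃CoPR θ p k`,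
`Scorr 0 :≡ ⊥`, induced `R`. [cite: Balaban1988Convergent, p.244 and remark p.262; Balaban1989LargeFieldI, (0.2)–(0.3) p.176] -/
def VOfRecord₁₃CoPR (θ : Stage13RParams F N) (p : B12.RunParams) : PrintedCarriers14R where
  P := F.P p.K
  G := SU N
  instGG := inferInstance
  instMS := inferInstance
  instHD := inferInstance
  K := p.K
  R := fun k => inducedAt (tdensOfRecord₁₃ F N θ.toStage13Params p k) (densOfRecord₁₃ F N θ.toStage13Params p (k + 1))
  Scorr := fun j ρ' => match j with
    | 0 => False
    | k + 1 => ρ' = tdensOfRecord₁₃ F N θ.toStage13Params p k ∧ TLaw₁₃CoPR F N θ p k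
  S := fun j ρ => ρ = densOfRecord₁₃ F N θ.toStage13Params p j ∧ SLaw₁₃CoPR F N θ p j

/-- The pinned density operation maps `𝐓ρ_k ↦ ρ_{k+1}`. [cite: Balaban1989LargeFieldI, (0.2)–(0.3) p.176 (bookkeeping)] -/
theorem R_VOfRecord₁₃CoPR_tdens (θ : Stage13RParams F N) (p : B12.RunParams) (k : ℕ) :
    (VOfRecord₁₃CoPR F N θ p).R k (tdensOfRecord₁₃ F N θ.toStage13Params p k) = densOfRecord₁₃ F N θ.toStage13Params p (k + 1) :=
  inducedAt_self _ _

/-- **[III] p. 244's LEAF AT THE STAGE-13 CARRIERS**: `ROpLeaf (VOfRecord₁₃CoPR θ p) ↔ ∀ k < K, TLaw₁₃CoPR θ p k → SLaw₁₃CoPR θ p (k+1)`.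
[cite: Balaban1988Convergent, p.244, Thm 2 p.263 and remark p.262 (bookkeeping)] -/
theorem rOpLeaf_VOfRecord₁₃CoPR_iff (θ : Stage13RParams F N) (p : B12.RunParams) :
    ROpLeaf (VOfRecord₁₃CoPR F N θ p) ↔ ∀ k, k < p.K → TLaw₁₃CoPR F N θ p k → SLaw₁₃CoPR F N θ p (k + 1) := by
  rw [rOpLeaf_iff]
  refine ⟨fun h k hk hT => ?_, fun h k hk ρ' hρ' => ?_⟩
  · have hS := h k hk (tdensOfRecord₁₃ F N θ.toStage13Params p k) ⟨rfl, hT⟩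
    rw [R_VOfRecord₁₃CoPR_tdens] at hS
    exact hS.2
  · obtain ⟨rfl, hT⟩ := hρ'
    show (VOfRecord₁₃CoPR F N θ p).S (k + 1) ((VOfRecord₁₃CoPR F N θ p).R k (tdensOfRecord₁₃ F N θ.toStage13Params p k))
    rw [R_VOfRecord₁₃CoPR_tdens]
    exact ⟨rfl, h k hk hT⟩

/-- **THE STAGE-13 RESIDUAL**: Stage 8's residual with the 𝐑-carriers `VOfRecord₁₃CoPR`, the β RE-POINT `βfun := betaOfRecord₁₃` (the χ-generic β at `TcanOfRecord` and the
(2.9) species), `E`, `χ := chiβOfRecord₁₃ θ` along `gOfRecord₁₃`, the four action∕format fields over def-B's transport-generic layer AT `TβOfRecord₁₃ = TcanOfRecord`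
and `chiβOfRecord₁₃ θ`, and `S218 := S218OfRecord₁₃CoPR` PINNED.
[cite: Balaban1988Convergent, p.244, (2.18) p.257; Balaban1989LargeFieldI, (0.2)–(0.6) pp.176–177; Balaban1987RG1, (0.19) p.255, p.259 (dictionary; bookkeeping)] -/
def residualOfStage13CoPR (θ : Stage13RParams F N) : Residual₅ F N :=
  { residualOfStage8 F N θ.toStage8Params with
    V := VOfRecord₁₃CoPR F N θ
    βfun := betaOfRecord₁₃ F N θ.toStage13Params
    χ := fun p k => chiβOfRecord₁₃ F N θ.toStage13Params p.K (gOfRecord₁₃ F N θ.toStage13Params p) k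
    E := EOfRecord₁₃ F N θ.toStage13Params
    effAction := effActionOfRecordT F N (TβOfRecord₁₃ F N) (chiβOfRecord₁₃ F N θ.toStage13Params) (betaOfRecord₁₃ F N θ.toStage13Params)
    Ek := EkOfRecordT F N (TβOfRecord₁₃ F N) (chiβOfRecord₁₃ F N θ.toStage13Params) θ.εbg (betaOfRecord₁₃ F N θ.toStage13Params)
    ReprA := ReprAOfRecordT F N (TβOfRecord₁₃ F N) (chiβOfRecord₁₃ F N θ.toStage13Params) θ.εbg (betaOfRecord₁₃ F N θ.toStage13Params)
    IndA := IndAOfRecordT F N (TβOfRecord₁₃ F N) (chiβOfRecord₁₃ F N θ.toStage13Params) θ.εbg (betaOfRecord₁₃ F N θ.toStage13Params)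
    S218 := S218OfRecord₁₃CoPR F N θ }

/-- **The Stage-5 VIEW of Stage-13 parameters, Stage-13 residual**. [cite: Balaban1989LargeFieldII, Thm 1 p.355 (bookkeeping)] -/
def Stage13RParams.toStage5₁₃CoPR (θ : Stage13RParams F N) : Stage5Params F N :=
  { θ.toStage5Params with res := residualOfStage13CoPR F N θ }

/-- The view's 𝐑-carriers ARE the pinned ones (`rfl`). [cite: Balaban1988Convergent, p.244 (bookkeeping)] -/
theorem Stage13RParams.toStage5₁₃CoPR_res_V (θ : Stage13RParams F N) (p : B12.RunParams) : (θ.toStage5₁₃CoPR F N).res.V p = VOfRecord₁₃CoPR F N θ p := rfl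

/-- The view's format slot IS the Stage-13 predicate of record (`rfl`). [cite: Balaban1988Convergent, (2.18) p.257 (bookkeeping)] -/
theorem Stage13RParams.toStage5₁₃CoPR_res_S218 (θ : Stage13RParams F N) : (θ.toStage5₁₃CoPR F N).res.S218 = S218OfRecord₁₃CoPR F N θ := rfl

/-- The view's β-functions ARE `betaOfRecord₁₃ θ` (`rfl`). [cite: Balaban1987RG1, (1.20)–(1.22) p.264 (bookkeeping)] -/
theorem Stage13RParams.toStage5₁₃CoPR_res_βfun (θ : Stage13RParams F N) : (θ.toStage5₁₃CoPR F N).res.βfun = betaOfRecord₁₃ F N θ.toStage13Params := rfl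

/-- **THE RECORD'S 𝐑-LEAF, UNFOLDED** at the C-binding of record over the Stage-13 view. [cite: Balaban1988Convergent, p.244 and Thm 2 p.263; Balaban1989LargeFieldII, Thm 1 p.355 (bookkeeping)] -/
theorem rOperation_upOfRecord₅C_stage13CoPR_iff (θ : Stage13RParams F N) (p : B12.RunParams) :
    (upOfRecord₅C F N (θ.toStage5₁₃CoPR F N) p).rOperation ↔ ∀ k, k < p.K → TLaw₁₃CoPR F N θ p k → SLaw₁₃CoPR F N θ p (k + 1) := by
  show ROpLeaf (VOfRecord₁₃CoPR F N θ p) ↔ _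
  exact rOpLeaf_VOfRecord₁₃CoPR_iff F N θ p

/-- **THE CORE OF RECORD at `θ`, Stage 13** (`RGMachineCore`, by hand, as FILE 10's `coreOfRecord₁₀` with `TcOfRecord ↦ TβOfRecord₁₃ = TcanOfRecord`, `chiFixed7 ↦ chiβOfRecord₁₃ θ = chiFixed29 θ.ν θ.ε₂₉` and the ₁₃ plugs):
`Sect2Form p k := S218OfRecord₁₃CoPR θ p k ρ_k` READ AT `densOfRecord₁₃`. [cite: Balaban1987RG1, (0.17)–(0.24) pp.255–257, p.259; Balaban1988Convergent, (2.17)–(2.18) p.257, Thm 1 p.262 (dictionary; bookkeeping)] -/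
def coreOfRecord₁₃CoPR (θ : Stage13RParams F N) : RGMachineCore F (SU N) where
  βfun := betaOfRecord₁₃ F N θ.toStage13Params
  E := EOfRecord₁₃ F N θ.toStage13Params
  dom := fun p k => domAltOfRecord F N θ.ν p.K k
  effAction := effActionOfRecordT F N (TβOfRecord₁₃ F N) (chiβOfRecord₁₃ F N θ.toStage13Params) (betaOfRecord₁₃ F N θ.toStage13Params)
  wilsonBG := wilsonBGOfRecord F N θ.εbg
  Ek := EkOfRecordT F N (TβOfRecord₁₃ F N) (chiβOfRecord₁₃ F N θ.toStage13Params) θ.εbg (betaOfRecord₁₃ F N θ.toStage13Params)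
  χ := fun p k => chiβOfRecord₁₃ F N θ.toStage13Params p.K (gOfRecord₁₃ F N θ.toStage13Params p) k
  Repr := fun p k => ReprAOfRecordT F N (TβOfRecord₁₃ F N) (chiβOfRecord₁₃ F N θ.toStage13Params) θ.εbg (betaOfRecord₁₃ F N θ.toStage13Params) p k
    (prefixOf (gOfRecord₁₃ F N θ.toStage13Params p) k) (domAltOfRecord F N θ.ν p.K k)
    (effActionOfRecordT F N (TβOfRecord₁₃ F N) (chiβOfRecord₁₃ F N θ.toStage13Params) (betaOfRecord₁₃ F N θ.toStage13Params) p k)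
    (wilsonBGOfRecord F N θ.εbg p k) (EkOfRecordT F N (TβOfRecord₁₃ F N) (chiβOfRecord₁₃ F N θ.toStage13Params) θ.εbg (betaOfRecord₁₃ F N θ.toStage13Params) p k)
  IndAss := fun p k => IndAOfRecordT F N (TβOfRecord₁₃ F N) (chiβOfRecord₁₃ F N θ.toStage13Params) θ.εbg (betaOfRecord₁₃ F N θ.toStage13Params) p k
    (prefixOf (gOfRecord₁₃ F N θ.toStage13Params p) k) (domAltOfRecord F N θ.ν p.K k)
    (effActionOfRecordT F N (TβOfRecord₁₃ F N) (chiβOfRecord₁₃ F N θ.toStage13Params) (betaOfRecord₁₃ F N θ.toStage13Params) p k)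
    (wilsonBGOfRecord F N θ.εbg p k) (EkOfRecordT F N (TβOfRecord₁₃ F N) (chiβOfRecord₁₃ F N θ.toStage13Params) θ.εbg (betaOfRecord₁₃ F N θ.toStage13Params) p k)
  Sect2Form := fun p k => S218OfRecord₁₃CoPR F N θ p k (densOfRecord₁₃ F N θ.toStage13Params p k)

/-- The core's Wilson start IS `ρ₀` of record. [cite: Balaban1988Convergent, Thm 1 p.262 (bookkeeping)] -/
theorem rhoZero_coreOfRecord₁₃CoPR (θ : Stage13RParams F N) (p : B12.RunParams) :
    (coreOfRecord₁₃CoPR F N θ).rhoZero p = densOfRecord₁₃ F N θ.toStage13Params p 0 := by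
  rw [densOfRecord₁₃_zero]
  rfl

/-- The core's §2 clause IS `SLaw₁₃CoPR` (`Iff.rfl`). [cite: Balaban1988Convergent, (2.18) p.257, Thm 1 p.262 (bookkeeping)] -/
theorem sect2Form_coreOfRecord₁₃CoPR_iff (θ : Stage13RParams F N) (p : B12.RunParams) (k : ℕ) :
    (coreOfRecord₁₃CoPR F N θ).Sect2Form p k ↔ SLaw₁₃CoPR F N θ p k := Iff.rfl

/-- The core's β IS the χ-generic β at the canonical-version transport and the (2.9) species (`rfl`). [cite: Balaban1987RG1, (1.20)–(1.22) p.264 (bookkeeping)] -/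
theorem βfun_coreOfRecord₁₃CoPR (θ : Stage13RParams F N) :
    (coreOfRecord₁₃CoPR F N θ).βfun = betaOfRecord₈Tχ F N (TcanOfRecord F N) (chiFixed29 F N θ.ν θ.ε₂₉) θ.toStage8Params := rfl

end FormSideCoPR

/-! ## §2 (R). THE bg-FREE CORE TOWER ∕ DATUM keyed on `Provisos₁₃CoPR` (§0); rfl faces — FILE 23 §2 VERBATIM under KEY-RULE-25 -/

section CoreTowerCoPR

open Classical in
/-- **THE TOWER OF RECORD at `θ` keyed on the bg-free CORE, AT PRINT'S BACKGROUND** (v1.6 `R` image of the Co twin of v1.2's `towerOfRecord₁₃Core`), BY HAND exactly as it (which reads `h` only through `tstep` ∕ `rstep`).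
[cite: Balaban1988Convergent, (0.2) p.244, (2.18) p.257, (3.25) p.270; Balaban1989LargeFieldI, (0.4) p.176] -/
def towerOfRecord₁₃CoPR (θ : Stage13RParams F N) (h : θ.Provisos₁₃CoPR F N) : (coreOfRecord₁₃CoPR F N θ).Tower (avOfRecord F N) where
  ρ := fun p k => densOfRecord₁₃ F N θ.toStage13Params p k
  Trho := fun p k => tdensOfRecord₁₃ F N θ.toStage13Params p k
  rho_zero := fun p => (rhoZero_coreOfRecord₁₃CoPR F N θ p).symm
  isRT_Trho := fun p k hk => isRT_trhoOfRecord9 F N θ.ν θ.τ9 (EOfRecord₁₃ F N θ.toStage13Params) (wOfRecord₉ F N θ.toStage9Params) θ.ppSel p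
    (gOfRecord₁₃ F N θ.toStage13Params p) k hk (h.tstep p k hk)
  integral_succ := fun p k hk => integral_densOfRecord₁₃_succ F N θ.toStage13Params p k (h.rstep p k hk)

/-- **THE DATUM OF RECORD keyed on the bg-free CORE, Stage 13, AT PRINT'S BACKGROUND** (v1.6 `R` image of the Co twin of v1.2's `datumOfRecord₁₃Core`). [cite: Balaban1989LargeFieldII, Thm 1 + (0.1) pp.355–356; Balaban1988Convergent, (0.2) p.244] -/
def datumOfRecord₁₃CoPR (θ : Stage13RParams F N) (h : θ.Provisos₁₃CoPR F N) : FiniteEpsData F (SU N) :=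
  datumOfTower F N (coreOfRecord₁₃CoPR F N θ) (towerOfRecord₁₃CoPR F N θ h)

/-- FACE `dens` of the core-keyed Co datum (`rfl`). [cite: Balaban1988Convergent, (2.18) p.257 (bookkeeping)] -/
theorem dens_datumOfRecord₁₃CoPR (θ : Stage13RParams F N) (h : θ.Provisos₁₃CoPR F N) (K : ℕ) (g₀ : ℝ) (k : ℕ) :
    (datumOfRecord₁₃CoPR F N θ h).dens K g₀ k = densOfRecord₁₃ F N θ.toStage13Params ⟨K, F.m, g₀⟩ k := rfl

/-- FACE construction of the core-keyed Co datum (`rfl`). [cite: Balaban1989LargeFieldII, Thm 1 + (0.1) pp.355–356 (bookkeeping)] -/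
theorem datumOfRecord₁₃CoPR_C (θ : Stage13RParams F N) (h : θ.Provisos₁₃CoPR F N) :
    (datumOfRecord₁₃CoPR F N θ h).C = (coreOfRecord₁₃CoPR F N θ).construction (densOfRecord₁₃ F N θ.toStage13Params) := rfl

/-- FACE β of the core-keyed Co datum (`rfl`). [cite: Balaban1987RG1, (1.20)–(1.22) p.264 (bookkeeping)] -/
theorem βfun_datumOfRecord₁₃CoPR (θ : Stage13RParams F N) (h : θ.Provisos₁₃CoPR F N) :
    (datumOfRecord₁₃CoPR F N θ h).βfun = betaOfRecord₁₃ F N θ.toStage13Params := rfl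

/-- FACE flow of the core-keyed Co datum (`rfl`). [cite: Balaban1987RG1, (0.17)–(0.20) pp.255–256 (bookkeeping)] -/
theorem flow_g_datumOfRecord₁₃CoPR (θ : Stage13RParams F N) (h : θ.Provisos₁₃CoPR F N) (p : B12.RunParams) :
    ((datumOfRecord₁₃CoPR F N θ h).C p).flow.g = gOfRecord₁₃ F N θ.toStage13Params p := rfl

/-- FACE av of the core-keyed Co datum (`rfl`). [cite: Balaban1987RG1, (0.4) p.253 (bookkeeping)] -/
theorem av_datumOfRecord₁₃CoPR (θ : Stage13RParams F N) (h : θ.Provisos₁₃CoPR F N) : (datumOfRecord₁₃CoPR F N θ h).av = avOfRecord F N := rfl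

/-- STAGE-0 DATUM CLAUSE at the core-keyed Co datum (`rfl`). [cite: Balaban1987RG1, (0.3)–(0.4) p.253] -/
theorem isDatumOfRecord₀_datumOfRecord₁₃CoPR (θ : Stage13RParams F N) (h : θ.Provisos₁₃CoPR F N) :
    IsDatumOfRecord₀ F N (datumOfRecord₁₃CoPR F N θ h) := rfl

/-- BINDER B1 = NODE N23 at the core-keyed Co datum. [cite: Balaban1987RG1, (0.4) p.253] -/
theorem isPrintedAveraged_datumOfRecord₁₃CoPR (θ : Stage13RParams F N) (h : θ.Provisos₁₃CoPR F N) : (datumOfRecord₁₃CoPR F N θ h).IsPrintedAveraged :=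
  isPrintedAveraged_datumOfTower F N _ _

end CoreTowerCoPR

/-! ## §3 (R). THE CORE RECORD FAMILY (bg-free) over the run-indexed slot: tower ∕ datum faces, [V] Thm 1 induction sockets, the record predicate
`IsRecordOfRecord₁₃CCoPR` (`∃ (θ : Stage13RParams F N) (h : θ.Provisos₁₃CoPR F N), …`), its consequences, the Stage-5 shadow, the node sockets, the β-layer faces — FILE 23 §3 VERBATIM under KEY-RULE-25 -/

section CoreRecordCoPR

/-- (v1.6 `R` · Co · bg-FREE PROVISO CORE) The tower's densities ARE `densOfRecord₁₃` (`rfl`). [cite: Balaban1988Convergent, (2.18) p.257 (bookkeeping)] -/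
theorem towerOfRecord₁₃CoPR_ρ (θ : Stage13RParams F N) (h : θ.Provisos₁₃CoPR F N) (p : B12.RunParams) (k : ℕ) :
    (towerOfRecord₁₃CoPR F N θ h).ρ p k = densOfRecord₁₃ F N θ.toStage13Params p k := rfl

/-- (v1.6 `R` · Co · bg-FREE PROVISO CORE) The tower's `𝐓ρ_k` ARE `tdensOfRecord₁₃` (`rfl`). [cite: Balaban1988Convergent, (3.25) p.270 (bookkeeping)] -/
theorem towerOfRecord₁₃CoPR_Trho (θ : Stage13RParams F N) (h : θ.Provisos₁₃CoPR F N) (p : B12.RunParams) (k : ℕ) :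
    (towerOfRecord₁₃CoPR F N θ h).Trho p k = tdensOfRecord₁₃ F N θ.toStage13Params p k := rfl

/-- (v1.6 `R` · Co · bg-FREE PROVISO CORE) `ρ₀` of the tower is integrable on every run: `e^{−E(p)}` times the Wilson–Boltzmann weight (`Missing.integrable_boltzmann`). [cite: Balaban1988Convergent, Thm 1 p.262 (bookkeeping)] -/
theorem integrable_towerOfRecord₁₃CoPR_ρ_zero (θ : Stage13RParams F N) (h : θ.Provisos₁₃CoPR F N) (p : B12.RunParams) :
    Integrable ((towerOfRecord₁₃CoPR F N θ h).ρ p 0) (fieldMeasure (F.P p.K) 0 (SU N)) := by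
  rw [(towerOfRecord₁₃CoPR F N θ h).rho_zero p]
  exact (Missing.integrable_boltzmann RegularGaugeGroup.measurable_reTr (F.P p.K) (sq_nonneg _)).const_mul _

open Classical in
/-- (v1.6 `R` · Co · bg-FREE PROVISO CORE) `ρ_{k+1}` of the tower is integrable, `k < K`: the (0.3)-density of the R-stepped pre-𝐑 slot under the integrable-form `rstep` (def-R's
`integrable_densityOfSlice_rstepSlotOfRecord_of_provisosInt`). [cite: Balaban1989LargeFieldI, (0.3)–(0.4) p.176 (bookkeeping)] -/
theorem integrable_towerOfRecord₁₃CoPR_ρ_succ (θ : Stage13RParams F N) (h : θ.Provisos₁₃CoPR F N) (p : B12.RunParams) (k : ℕ) (hk : k < p.K) :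
    Integrable ((towerOfRecord₁₃CoPR F N θ h).ρ p (k + 1)) (fieldMeasure (F.P p.K) (k + 1) (SU N)) := by
  rw [towerOfRecord₁₃CoPR_ρ, densOfRecord₁₃_succ]
  exact integrable_densityOfSlice_rstepSlotOfRecord_of_provisosInt F N θ.ν θ.τ9 _ θ.ppSel p _ (k + 1) (h.rstep p k hk)

/-- (v1.6 `R` · Co · bg-FREE PROVISO CORE) **THE TOWER OF RECORD IS INTEGRABLE** (`RGMachineCore.Tower.IsIntegrable`): every `ρ_k`, `k ≤ K`, from the displayed provisos alone. [cite: Balaban1988Convergent, (0.2) p.244 (bookkeeping)] -/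
theorem isIntegrable_towerOfRecord₁₃CoPR (θ : Stage13RParams F N) (h : θ.Provisos₁₃CoPR F N) : (towerOfRecord₁₃CoPR F N θ h).IsIntegrable
  | p, 0, _ => integrable_towerOfRecord₁₃CoPR_ρ_zero F N θ h p
  | p, k + 1, hk => integrable_towerOfRecord₁₃CoPR_ρ_succ F N θ h p k (Nat.lt_of_succ_le hk)

/-- (v1.6 `R` · Co · bg-FREE PROVISO CORE) … and every `𝐓ρ_k`, `k < K`, is integrable (def-T's `integrable_piece_trhoOfRecord9` summed). [cite: Balaban1988Convergent, (3.25) p.270 (bookkeeping)] -/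
theorem integrable_towerOfRecord₁₃CoPR_Trho (θ : Stage13RParams F N) (h : θ.Provisos₁₃CoPR F N) (p : B12.RunParams) (k : ℕ) (hk : k < p.K) :
    Integrable ((towerOfRecord₁₃CoPR F N θ h).Trho p k) (fieldMeasure (F.P p.K) (k + 1) (SU N)) :=
  integrable_finsetSum Finset.univ (fun s' _ => integrable_piece_trhoOfRecord9 F N θ.ν θ.τ9 (EOfRecord₁₃ F N θ.toStage13Params) (wOfRecord₉ F N θ.toStage9Params)
    θ.ppSel p (gOfRecord₁₃ F N θ.toStage13Params p) k hk (h.tstep p k hk) s')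

/-- (v1.6 `R` · Co · bg-FREE PROVISO CORE) FACE `Trho` (`rfl`). [cite: Balaban1988Convergent, (3.25) p.270 (bookkeeping)] -/
theorem trho_datumOfRecord₁₃CoPR (θ : Stage13RParams F N) (h : θ.Provisos₁₃CoPR F N) (K : ℕ) (g₀ : ℝ) (k : ℕ) :
    (datumOfRecord₁₃CoPR F N θ h).real.Trho K g₀ k = tdensOfRecord₁₃ F N θ.toStage13Params ⟨K, F.m, g₀⟩ k := rfl

/-- (v1.6 `R` · Co · bg-FREE PROVISO CORE) FACE `𝐑` (`rfl`). [cite: Balaban1989LargeFieldI, (0.2)–(0.3) p.176 (bookkeeping)] -/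
theorem R_datumOfRecord₁₃CoPR_eq_VOfRecord₁₃CoPR (θ : Stage13RParams F N) (h : θ.Provisos₁₃CoPR F N) (K : ℕ) (g₀ : ℝ) (k : ℕ) :
    (datumOfRecord₁₃CoPR F N θ h).real.R K g₀ k = (VOfRecord₁₃CoPR F N θ ⟨K, F.m, g₀⟩).R k := rfl

/-- (v1.6 `R` · Co · bg-FREE PROVISO CORE) … and maps `𝐓ρ_k ↦ ρ_{k+1}`. [cite: Balaban1988Convergent, (0.2) p.244; Balaban1989LargeFieldI, (0.3) p.176] -/
theorem R_tdens_datumOfRecord₁₃CoPR (θ : Stage13RParams F N) (h : θ.Provisos₁₃CoPR F N) (K : ℕ) (g₀ : ℝ) (k : ℕ) :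
    (datumOfRecord₁₃CoPR F N θ h).real.R K g₀ k (tdensOfRecord₁₃ F N θ.toStage13Params ⟨K, F.m, g₀⟩ k) =
      densOfRecord₁₃ F N θ.toStage13Params ⟨K, F.m, g₀⟩ (k + 1) :=
  (towerOfRecord₁₃CoPR F N θ h).inducedR_Trho ⟨K, F.m, g₀⟩ k

/-- (v1.6 `R` · Co · bg-FREE PROVISO CORE) … i.e. the χ-generic β at `T := TcanOfRecord`, `χ := chiFixed29 θ.ν θ.ε₂₉` (`rfl`). [cite: Balaban1987RG1, (1.20)–(1.22) p.264, (2.9) p.266 (bookkeeping)] -/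
theorem βfun_datumOfRecord₁₃CoPR_eq_betaOfRecord₈Tχ (θ : Stage13RParams F N) (h : θ.Provisos₁₃CoPR F N) :
    (datumOfRecord₁₃CoPR F N θ h).βfun = betaOfRecord₈Tχ F N (TcanOfRecord F N) (chiFixed29 F N θ.ν θ.ε₂₉) θ.toStage8Params := rfl

/-- (v1.6 `R` · Co · bg-FREE PROVISO CORE) FACE χ ∕ actions ∕ `IndAss` ∕ `Repr`: the Stage-13 core's fields (`rfl`). [cite: Balaban1987RG1, (0.17)–(0.24) pp.255–257 (bookkeeping)] -/
theorem actionSide_stage13CoPR (θ : Stage13RParams F N) (h : θ.Provisos₁₃CoPR F N) (p : B12.RunParams) (k : ℕ) :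
    ((datumOfRecord₁₃CoPR F N θ h).C p).χ k = (coreOfRecord₁₃CoPR F N θ).χ p k ∧
      ((datumOfRecord₁₃CoPR F N θ h).C p).effAction k = (coreOfRecord₁₃CoPR F N θ).effAction p k ∧
        ((datumOfRecord₁₃CoPR F N θ h).C p).Ek k = (coreOfRecord₁₃CoPR F N θ).Ek p k ∧
          (((datumOfRecord₁₃CoPR F N θ h).C p).IndAss k ↔ (coreOfRecord₁₃CoPR F N θ).IndAss p k) ∧
            (((datumOfRecord₁₃CoPR F N θ h).C p).Repr k ↔ (coreOfRecord₁₃CoPR F N θ).Repr p k) :=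
  ⟨rfl, rfl, rfl, Iff.rfl, Iff.rfl⟩

/-- (v1.6 `R` · Co · bg-FREE PROVISO CORE) **FACE `Sect2Form`**: the construction's §2 [III] clause at step `k` IS the repaired §2 form of the post-𝐑 slot family of `ρ_k`, Stage 13.
[cite: Balaban1988Convergent, (2.17)–(2.18) p.257, (2.23)–(2.42) pp.258–261, Thm 1 p.262] -/
theorem sect2Form_stage13CoPR_iff (θ : Stage13RParams F N) (h : θ.Provisos₁₃CoPR F N) (p : B12.RunParams) (k : ℕ) :
    ((datumOfRecord₁₃CoPR F N θ h).C p).Sect2Form k ↔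
      HasSect2FormAEZ F N (FluctV N) p.K (settingOfRecord₁₃ F N θ.toStage13Params p) (θ.Rz p.K) (WtOfRecord₁₃R F N θ p) k
        (UbgOfRecord₁₃CoP F N θ.toStage13Params p k)
        (slotsOfRecord F N θ.ν θ.τ9 (EOfRecord₁₃ F N θ.toStage13Params) (wOfRecord₉ F N θ.toStage9Params) θ.ppSel p
          (gOfRecord₁₃ F N θ.toStage13Params p) k) :=
  sLaw₁₃CoPR_iff F N θ p k

/-- (v1.6 `R` · Co · bg-FREE PROVISO CORE) (2.18) holds for the datum's densities with `rep_k` of record, by construction. [cite: Balaban1988Convergent, (2.18) p.257] -/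
theorem holds_dens_datumOfRecord₁₃CoPR (θ : Stage13RParams F N) (h : θ.Provisos₁₃CoPR F N) (K : ℕ) (g₀ : ℝ) (k : ℕ) :
    (reprOfRecord₁₃ F N θ.toStage13Params ⟨K, F.m, g₀⟩ k).Holds ((datumOfRecord₁₃CoPR F N θ h).dens K g₀ k) :=
  holds_densOfRecord₁₃ F N θ.toStage13Params _ k

/-- (v1.6 `R` · Co · bg-FREE PROVISO CORE) FACE Wilson start. [cite: Balaban1988Convergent, Thm 1 p.262] -/
theorem dens_zero_datumOfRecord₁₃CoPR (θ : Stage13RParams F N) (h : θ.Provisos₁₃CoPR F N) (K : ℕ) (g₀ : ℝ) :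
    (datumOfRecord₁₃CoPR F N θ h).dens K g₀ 0 = rhoZeroOfRecord F N K g₀ (EOfRecord₁₃ F N θ.toStage13Params ⟨K, F.m, g₀⟩) :=
  densOfRecord₁₃_zero F N θ.toStage13Params ⟨K, F.m, g₀⟩

/-- (v1.6 `R` · Co · bg-FREE PROVISO CORE) FACE push-forward: `𝐓ρ_k` IS an averaging-of-record image of `ρ_k` (`k < K`). [cite: Balaban1988Convergent, (3.1) p.264, (3.24)–(3.25) p.270] -/
theorem isRT_trho_datumOfRecord₁₃CoPR (θ : Stage13RParams F N) (h : θ.Provisos₁₃CoPR F N) (K : ℕ) (g₀ : ℝ) (k : ℕ) (hk : k < K) :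
    IsRT (avOfRecord F N K k).avg ((datumOfRecord₁₃CoPR F N θ h).dens K g₀ k) ((datumOfRecord₁₃CoPR F N θ h).real.Trho K g₀ k) :=
  (towerOfRecord₁₃CoPR F N θ h).isRT_Trho ⟨K, F.m, g₀⟩ k hk

/-- (v1.6 `R` · Co · bg-FREE PROVISO CORE) FACE (0.4) at the step: `∫ρ_{k+1} = ∫𝐓ρ_k` (`k < K`). [cite: Balaban1989LargeFieldI, (0.4) p.176] -/
theorem integral_dens_succ_datumOfRecord₁₃CoPR (θ : Stage13RParams F N) (h : θ.Provisos₁₃CoPR F N) (K : ℕ) (g₀ : ℝ) (k : ℕ) (hk : k < K) :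
    ∫ V, (datumOfRecord₁₃CoPR F N θ h).dens K g₀ (k + 1) V ∂fieldMeasure (F.P K) (k + 1) (SU N)
      = ∫ V, (datumOfRecord₁₃CoPR F N θ h).real.Trho K g₀ k V ∂fieldMeasure (F.P K) (k + 1) (SU N) :=
  (towerOfRecord₁₃CoPR F N θ h).integral_succ ⟨K, F.m, g₀⟩ k hk

/-- (v1.6 `R` · Co · bg-FREE PROVISO CORE) `∫ρ_k = ∫ρ₀` along every run, `k ≤ K`. [cite: Balaban1985UV3, (6) p.257] -/
theorem integral_dens_eq_zero_datumOfRecord₁₃CoPR (θ : Stage13RParams F N) (h : θ.Provisos₁₃CoPR F N) (K : ℕ) (g₀ : ℝ) (k : ℕ) (hk : k ≤ K) :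
    ∫ V, (datumOfRecord₁₃CoPR F N θ h).dens K g₀ k V ∂fieldMeasure (F.P K) k (SU N)
      = ∫ U, (datumOfRecord₁₃CoPR F N θ h).dens K g₀ 0 U ∂fieldMeasure (F.P K) 0 (SU N) :=
  (towerOfRecord₁₃CoPR F N θ h).integral_eq_integral_zero ⟨K, F.m, g₀⟩ k hk

/-- (v1.6 `R` · Co · bg-FREE PROVISO CORE) FACE integrability: every density of the datum, `k ≤ K`, is integrable. [cite: Balaban1988Convergent, (0.2) p.244 (bookkeeping)] -/
theorem integrable_dens_datumOfRecord₁₃CoPR (θ : Stage13RParams F N) (h : θ.Provisos₁₃CoPR F N) (K : ℕ) (g₀ : ℝ) (k : ℕ) (hk : k ≤ K) :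
    Integrable ((datumOfRecord₁₃CoPR F N θ h).dens K g₀ k) (fieldMeasure (F.P K) k (SU N)) :=
  isIntegrable_towerOfRecord₁₃CoPR F N θ h ⟨K, F.m, g₀⟩ k hk

/-- (v1.6 `R` · Co · bg-FREE PROVISO CORE) … and so is every realised `𝐓ρ_k`, `k < K`. [cite: Balaban1988Convergent, (3.25) p.270 (bookkeeping)] -/
theorem integrable_trho_datumOfRecord₁₃CoPR (θ : Stage13RParams F N) (h : θ.Provisos₁₃CoPR F N) (K : ℕ) (g₀ : ℝ) (k : ℕ) (hk : k < K) :
    Integrable ((datumOfRecord₁₃CoPR F N θ h).real.Trho K g₀ k) (fieldMeasure (F.P K) (k + 1) (SU N)) :=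
  integrable_towerOfRecord₁₃CoPR_Trho F N θ h ⟨K, F.m, g₀⟩ k hk

/-- (v1.6 `R` · Co · bg-FREE PROVISO CORE) The T⁴ apex at the Stage-13 datum, B1 eliminated. [cite: JaffeWittenClay2006, §6.5 p.11] -/
theorem continuumYM4Torus_datumOfRecord₁₃CoPR (θ : Stage13RParams F N) (h : θ.Provisos₁₃CoPR F N)
    (hB : B16.EndStatementBPrinted (datumOfRecord₁₃CoPR F N θ h).C)
    (hE : EndpointExistence (datumOfRecord₁₃CoPR F N θ h).C.toB12)
    (hNE : T4ApexHybrid.HybridNE7Under (datumOfRecord₁₃CoPR F N θ h) (EndpointExistence (datumOfRecord₁₃CoPR F N θ h).C.toB12)) :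
    T4ContinuumYM4Torus.ContinuumYM4Torus (datumOfRecord₁₃CoPR F N θ h) :=
  continuumYM4Torus_datumOfTower F N _ _ hB hE hNE

/-- (v1.6 `R` · Co · bg-FREE PROVISO CORE) **THE BASE HOLDS** on every run of the Stage-13 datum (`sLaw₁₃CoPR_zero`). [cite: Balaban1988Convergent, Thm 1 p.262; Balaban1989LargeFieldII, Thm 1 p.355 (bookkeeping)] -/
theorem sect2Form_zero_datumOfRecord₁₃CoPR (θ : Stage13RParams F N) (h : θ.Provisos₁₃CoPR F N) (P : B12.RunParams) :
    ((datumOfRecord₁₃CoPR F N θ h).C P).Sect2Form 0 :=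
  (sect2Form_stage13CoPR_iff F N θ h P 0).mpr ((sLaw₁₃CoPR_iff F N θ P 0).mp (sLaw₁₃CoPR_zero F N θ P))

/-- (v1.6 `R` · Co · bg-FREE PROVISO CORE) **`B16.InductionBase` AT THE STAGE-13 DATUM, for every window letter `γ`, NO hypothesis.** [cite: Balaban1988Convergent, Thm 1 p.262; Balaban1989LargeFieldII, Thm 1 p.355 + p.391] -/
theorem inductionBase_datumOfRecord₁₃CoPR (θ : Stage13RParams F N) (h : θ.Provisos₁₃CoPR F N) (γ : ℝ) : B16.InductionBase (datumOfRecord₁₃CoPR F N θ h).C γ :=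
  fun P _ => sect2Form_zero_datumOfRecord₁₃CoPR F N θ h P

/-- (v1.6 `R` · Co · bg-FREE PROVISO CORE) **THE STEP OF THEOREM 1 AT THE OBJECTS OF RECORD, Stage 13**: along every run in the `γ`-window, from the 𝐓-STEP LAW «`SLaw₁₃CoPR k → TLaw₁₃CoPR k`» and the 𝐑-LEAF
`ROpLeaf (VOfRecord₁₃CoPR θ P)`.  Both hypotheses DISPLAYED. [cite: Balaban1989LargeFieldII, Thm 1 p.355 and pp.390–391; Balaban1988Convergent, Thm p.245, Thm 2 p.263] -/
theorem inductionStep_datumOfRecord₁₃CoPR_of_tLaw_rOpLeaf (θ : Stage13RParams F N) (h : θ.Provisos₁₃CoPR F N) (γ : ℝ)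
    (hT : ∀ P : B12.RunParams, ((datumOfRecord₁₃CoPR F N θ h).C P).flow.InInterval γ P.K →
      ∀ k, k < P.K → SLaw₁₃CoPR F N θ P k → TLaw₁₃CoPR F N θ P k)
    (hR : ∀ P : B12.RunParams, ((datumOfRecord₁₃CoPR F N θ h).C P).flow.InInterval γ P.K → ROpLeaf (VOfRecord₁₃CoPR F N θ P)) :
    B16.InductionStep (datumOfRecord₁₃CoPR F N θ h).C γ := by
  intro P hP k hk hS
  have hS' : SLaw₁₃CoPR F N θ P k := (sLaw₁₃CoPR_iff F N θ P k).mpr ((sect2Form_stage13CoPR_iff F N θ h P k).mp hS)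
  exact (sect2Form_stage13CoPR_iff F N θ h P (k + 1)).mpr
    ((sLaw₁₃CoPR_iff F N θ P (k + 1)).mp ((rOpLeaf_VOfRecord₁₃CoPR_iff F N θ P).mp (hR P hP) k hk (hT P hP k hk hS')))

/-- (v1.6 `R` · Co · bg-FREE PROVISO CORE) **[V] THEOREM 1 AT THE STAGE-13 DATUM FROM ITS PRINTED PIECES WITHOUT A BASE HYPOTHESIS.** [cite: Balaban1989LargeFieldII, Thm 1 p.355 + p.391; Balaban1988Convergent, Thm 1 p.262, Thm p.245, Thm 2 p.263] -/
theorem thm1Printed_datumOfRecord₁₃CoPR_of_tLaw_rOpLeaf (θ : Stage13RParams F N) (h : θ.Provisos₁₃CoPR F N) {γ : ℝ} (hγ : 0 < γ)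
    (hT : ∀ P : B12.RunParams, ((datumOfRecord₁₃CoPR F N θ h).C P).flow.InInterval γ P.K →
      ∀ k, k < P.K → SLaw₁₃CoPR F N θ P k → TLaw₁₃CoPR F N θ P k)
    (hR : ∀ P : B12.RunParams, ((datumOfRecord₁₃CoPR F N θ h).C P).flow.InInterval γ P.K → ROpLeaf (VOfRecord₁₃CoPR F N θ P)) :
    B16.Thm1Printed (datumOfRecord₁₃CoPR F N θ h).C :=
  B16.thm1_of_steps _ γ hγ (inductionBase_datumOfRecord₁₃CoPR F N θ h γ) (inductionStep_datumOfRecord₁₃CoPR_of_tLaw_rOpLeaf F N θ h γ hT hR)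

/-- (v1.6 `R` · Co · bg-FREE PROVISO CORE) **«(D, w) is the record, Stage 13»**: admissible Stage-13 parameters SATISFYING THE STAGE-13 PROVISOS whose Stage-13 datum of record IS `D`, and a world bound
to its construction with a window `0 < w.γ ≤ θ.γ`, Bałaban's block size and the C-binding of record over the Stage-13 view. [cite: Balaban1989LargeFieldII, Thm 1 + (0.1) pp.355–356; Balaban1988Convergent, (0.2) p.244, (2.17)–(2.18) p.257, Thms 1–2 pp.262–263; Balaban1989LargeFieldI, (0.2)–(0.4) p.176; Balaban1987RG1, p.259 (objects of record; bookkeeping)] -/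
def IsRecordOfRecord₁₃CCoPR (D : FiniteEpsData F (SU N)) (w : WorldP) : Prop :=
  ∃ (θ : Stage13RParams F N) (h : θ.Provisos₁₃CoPR F N), θ.Admissible F N ∧ D = datumOfRecord₁₃CoPR F N θ h ∧ w.C = D.C ∧ (0 < w.γ ∧ w.γ ≤ θ.γ) ∧
    w.L = (θ.L : ℝ) ∧ ∀ P : B12.RunParams, w.up P = upOfRecord₅C F N (θ.toStage5₁₃CoPR F N) P

/-- (v1.6 `R` · Co · bg-FREE PROVISO CORE) **Pointed form**. [cite: Balaban1989LargeFieldII, Thm 1 + (0.1) pp.355–356 (bookkeeping)] -/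
theorem isRecordOfRecord₁₃CCoPR_of_eq (θ : Stage13RParams F N) (h : θ.Provisos₁₃CoPR F N) (hθ : θ.Admissible F N) (w : WorldP)
    (hC : w.C = (datumOfRecord₁₃CoPR F N θ h).C) (hγ : 0 < w.γ ∧ w.γ ≤ θ.γ) (hL : w.L = (θ.L : ℝ))
    (hup : ∀ P, w.up P = upOfRecord₅C F N (θ.toStage5₁₃CoPR F N) P) :
    IsRecordOfRecord₁₃CCoPR F N (datumOfRecord₁₃CoPR F N θ h) w :=
  ⟨θ, h, hθ, rfl, hC, hγ, hL, hup⟩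

/-- (v1.6 `R` · Co · bg-FREE PROVISO CORE) **Every admissible Stage-12 parameter satisfying the Stage-13 provisos IS a Stage-13 record at some world**, with any window `0 < γw ≤ θ.γ`.
[cite: Balaban1989LargeFieldII, Thm 1 + (0.1) pp.355–356 (bookkeeping)] -/
theorem exists_world_isRecordOfRecord₁₃CCoPR (θ : Stage13RParams F N) (h : θ.Provisos₁₃CoPR F N) (hθ : θ.Admissible F N) {γw : ℝ} (hγw : 0 < γw ∧ γw ≤ θ.γ) :
    ∃ w : WorldP, IsRecordOfRecord₁₃CCoPR F N (datumOfRecord₁₃CoPR F N θ h) w ∧ w.γ = γw := by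
  obtain ⟨w₀⟩ := nonempty_worldP
  exact ⟨{ w₀ with
      C := (datumOfRecord₁₃CoPR F N θ h).C, γ := γw, L := (θ.L : ℝ), one_lt_L := by exact_mod_cast θ.hL.2,
      up := fun P => upOfRecord₅C F N (θ.toStage5₁₃CoPR F N) P },
    ⟨θ, h, hθ, rfl, rfl, hγw, rfl, fun _ => rfl⟩, rfl⟩

section ConsequencesCoPR

variable {F N}
variable {D : FiniteEpsData F (SU N)} {w : WorldP}

/-- (v1.6 `R` · Co · bg-FREE PROVISO CORE) A Stage-13 record CERTIFIES its parameters' provisos and admissibility. [cite: Balaban1989LargeFieldI, (0.3)–(0.4) p.176 (bookkeeping)] -/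
theorem exists_provisos_of_isRecordOfRecord₁₃CCoPR (h : IsRecordOfRecord₁₃CCoPR F N D w) :
    ∃ (θ : Stage13RParams F N) (hP : θ.Provisos₁₃CoPR F N), θ.Admissible F N ∧ D = datumOfRecord₁₃CoPR F N θ hP := by
  obtain ⟨θ, hP, hθ, hD, -⟩ := h
  exact ⟨θ, hP, hθ, hD⟩

/-- (v1.6 `R` · Co · bg-FREE PROVISO CORE) Binding clause 1: the world's construction IS the datum's. [cite: Balaban1989LargeFieldII, Thm 1 p.355 (bookkeeping)] -/
theorem construction_eq_of_isRecordOfRecord₁₃CCoPR (h : IsRecordOfRecord₁₃CCoPR F N D w) : w.C = D.C := by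
  obtain ⟨θ, hP, -, -, hC, -⟩ := h
  exact hC

/-- (v1.6 `R` · Co · bg-FREE PROVISO CORE) Binding clause 2: the interval constant is positive. [cite: Balaban1989LargeFieldII, Thm 1 p.355 (bookkeeping)] -/
theorem gamma_pos_of_isRecordOfRecord₁₃CCoPR (h : IsRecordOfRecord₁₃CCoPR F N D w) : 0 < w.γ := by
  obtain ⟨θ, hP, -, -, -, hγ, -⟩ := h
  exact hγ.1

/-- (v1.6 `R` · Co · bg-FREE PROVISO CORE) A Stage-13 record's datum is a datum of record, Stage 0. [cite: Balaban1987RG1, (0.3)–(0.4) p.253 (bookkeeping)] -/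
theorem isDatumOfRecord₀_of_isRecordOfRecord₁₃CCoPR (h : IsRecordOfRecord₁₃CCoPR F N D w) : IsDatumOfRecord₀ F N D := by
  obtain ⟨θ, hP, -, rfl, -⟩ := h
  exact isDatumOfRecord₀_datumOfRecord₁₃CoPR F N θ hP

/-- (v1.6 `R` · Co · bg-FREE PROVISO CORE) N23 · binder B1 at every Stage-13 record. [cite: Balaban1987RG1, (0.4) p.253] -/
theorem isPrintedAveraged_of_isRecordOfRecord₁₃CCoPR (h : IsRecordOfRecord₁₃CCoPR F N D w) : D.IsPrintedAveraged :=
  isPrintedAveraged_of_isDatumOfRecord₀ F N D (isDatumOfRecord₀_of_isRecordOfRecord₁₃CCoPR h)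

/-- (v1.6 `R` · Co · bg-FREE PROVISO CORE) **A Stage-13 record's 𝐑-leaf IS «repaired 𝐓-image form ⇒ repaired §2 form one level up» along its tower of record**, at every run.
[cite: Balaban1988Convergent, p.244, Thm 2 p.263; Balaban1989LargeFieldII, Thm 1 p.355 (bookkeeping)] -/
theorem exists_rOperation_iff_of_isRecordOfRecord₁₃CCoPR (h : IsRecordOfRecord₁₃CCoPR F N D w) :
    ∃ (θ : Stage13RParams F N) (hP : θ.Provisos₁₃CoPR F N), θ.Admissible F N ∧ D = datumOfRecord₁₃CoPR F N θ hP ∧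
      ∀ P : B12.RunParams, (leavesP w P).rOperation ↔ ∀ k, k < P.K → TLaw₁₃CoPR F N θ P k → SLaw₁₃CoPR F N θ P (k + 1) := by
  obtain ⟨θ, hP, hθ, hD, -, -, -, hup⟩ := h
  refine ⟨θ, hP, hθ, hD, fun P => ?_⟩
  show (w.up P).rOperation ↔ _
  rw [hup P]
  exact rOperation_upOfRecord₅C_stage13CoPR_iff F N θ P

/-- (v1.6 `R` · Co · bg-FREE PROVISO CORE) **AT A STAGE-13 RECORD WHOSE 𝐑-LEAVES HOLD, EVERY `ρ_{k+1}` WHOSE `𝐓ρ_k` HAS THE 𝐓-IMAGE FORM HAS THE REPAIRED §2 FORM OF RECORD.**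
[cite: Balaban1988Convergent, Thm 2 p.263, (2.18) p.257, (2.23) p.258 (bookkeeping)] -/
theorem hasSect2FormAEZ_succ_of_isRecordOfRecord₁₃CCoPR (h : IsRecordOfRecord₁₃CCoPR F N D w) (hR : ∀ P : B12.RunParams, (leavesP w P).rOperation) :
    ∃ (θ : Stage13RParams F N) (hP : θ.Provisos₁₃CoPR F N), θ.Admissible F N ∧ D = datumOfRecord₁₃CoPR F N θ hP ∧
      ∀ (P : B12.RunParams) (k : ℕ), k < P.K → TLaw₁₃CoPR F N θ P k →
        HasSect2FormAEZ F N (FluctV N) P.K (settingOfRecord₁₃ F N θ.toStage13Params P) (θ.Rz P.K) (WtOfRecord₁₃R F N θ P) (k + 1)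
          (UbgOfRecord₁₃CoP F N θ.toStage13Params P (k + 1))
          (slotsOfRecord F N θ.ν θ.τ9 (EOfRecord₁₃ F N θ.toStage13Params) (wOfRecord₉ F N θ.toStage9Params) θ.ppSel P
            (gOfRecord₁₃ F N θ.toStage13Params P) (k + 1)) := by
  obtain ⟨θ, hP, hθ, hD, hrop⟩ := exists_rOperation_iff_of_isRecordOfRecord₁₃CCoPR h
  exact ⟨θ, hP, hθ, hD, fun P k hk hT => (sLaw₁₃CoPR_iff F N θ P (k + 1)).mp (((hrop P).mp (hR P)) k hk hT)⟩

/-- (v1.6 `R` · Co · bg-FREE PROVISO CORE) **AT A STAGE-13 RECORD WHOSE 𝐑-LEAVES HOLD, [V] THEOREM 1 FOLLOWS FROM THE 𝐓-STEP LAW ALONE** (any window letter `γ > 0`).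
[cite: Balaban1989LargeFieldII, Thm 1 p.355 + p.391; Balaban1988Convergent, Thm 1 p.262, Thm p.245, Thm 2 p.263 (bookkeeping)] -/
theorem thm1Printed_of_isRecordOfRecord₁₃CCoPR_of_tLaw (h : IsRecordOfRecord₁₃CCoPR F N D w) (hR : ∀ P : B12.RunParams, (leavesP w P).rOperation) :
    ∃ (θ : Stage13RParams F N) (hP : θ.Provisos₁₃CoPR F N), θ.Admissible F N ∧ D = datumOfRecord₁₃CoPR F N θ hP ∧
      ∀ γ : ℝ, 0 < γ → (∀ P : B12.RunParams, (D.C P).flow.InInterval γ P.K → ∀ k, k < P.K → SLaw₁₃CoPR F N θ P k → TLaw₁₃CoPR F N θ P k) →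
        B16.Thm1Printed D.C := by
  obtain ⟨θ, hP, hθ, hD, hrop⟩ := exists_rOperation_iff_of_isRecordOfRecord₁₃CCoPR h
  refine ⟨θ, hP, hθ, hD, fun γ hγ hT => ?_⟩
  subst hD
  exact thm1Printed_datumOfRecord₁₃CoPR_of_tLaw_rOpLeaf F N θ hP hγ hT
    (fun P _ => (rOpLeaf_VOfRecord₁₃CoPR_iff F N θ P).mpr ((hrop P).mp (hR P)))

end ConsequencesCoPR

/-- (v1.6 `R` · Co · bg-FREE PROVISO CORE) **THE SHADOW RESIDUAL of `θ` under its Stage-13 provisos** (as FILE 12b: `R :=` the induced operation at the Radon–Nikodym image of the tower of record, the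
format slot FROZEN at the density of record).  A PROOF DEVICE. [cite: Balaban1989LargeFieldI, (0.2)–(0.4) p.176; Balaban1987RG1, (0.13) p.254 (bookkeeping)] -/
def shadowResidual₁₃CoPR (θ : Stage13RParams F N) (h : θ.Provisos₁₃CoPR F N) : Residual₅ F N :=
  { residualOfStage13CoPR F N θ with
    R := fun p k => (towerOfRecord₁₃CoPR F N θ h).shadowR p k
    preservesIntegral_R := fun p k hk => (towerOfRecord₁₃CoPR F N θ h).preservesIntegral_shadowR p k hk (avOfRecord_measurable F N p.K k)
      (avOfRecord_haarAC F N p.K k hk) (isIntegrable_towerOfRecord₁₃CoPR F N θ h p k hk.le)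
    integrable_R := fun p k hk => (towerOfRecord₁₃CoPR F N θ h).integrable_shadowR p k
      (isIntegrable_towerOfRecord₁₃CoPR F N θ h p (k + 1) (Nat.succ_le_of_lt hk))
    S218 := fun p k _ => S218OfRecord₁₃CoPR F N θ p k (densOfRecord₁₃ F N θ.toStage13Params p k) }

/-- (v1.6 `R` · Co · bg-FREE PROVISO CORE) **THE SHADOW Stage-5 parameters of `θ`** at interval letter `γ'`. [cite: Balaban1989LargeFieldI, (0.2) p.176 (bookkeeping)] -/
def shadow₅OfRecord₁₃CoPR (θ : Stage13RParams F N) (h : θ.Provisos₁₃CoPR F N) (γ' : ℝ) : Stage5Params F N :=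
  { θ.toStage5Params with γ := γ', res := shadowResidual₁₃CoPR F N θ h }

/-- (v1.6 `R` · Co · bg-FREE PROVISO CORE) THE KEY `rfl`: the machine of the shadow has core `coreOfRecord₁₃CoPR θ`. [cite: Balaban1988Convergent, (0.2) p.244 (bookkeeping)] -/
theorem toCore_machineOfRecord₅_shadow₁₃CoPR (θ : Stage13RParams F N) (h : θ.Provisos₁₃CoPR F N) (γ' : ℝ) :
    (machineOfRecord₅ F N (shadow₅OfRecord₁₃CoPR F N θ h γ')).toCore = coreOfRecord₁₃CoPR F N θ := rfl

/-- (v1.6 `R` · Co · bg-FREE PROVISO CORE) The shadow's residual `R` IS the tower's shadow operation (`rfl`). [cite: Balaban1989LargeFieldI, (0.3) p.176 (bookkeeping)] -/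
theorem res_R_shadow₁₃CoPR (θ : Stage13RParams F N) (h : θ.Provisos₁₃CoPR F N) (γ' : ℝ) (p : B12.RunParams) (k : ℕ) :
    (shadow₅OfRecord₁₃CoPR F N θ h γ').res.R p k = (towerOfRecord₁₃CoPR F N θ h).shadowR p k := rfl

/-- (v1.6 `R` · Co · bg-FREE PROVISO CORE) The shadow is Stage-5 admissible iff `θ`'s Stage-1 dictionary is admissible and `0 < γ'`. [cite: Balaban1989LargeFieldII, Thm 1 p.355 (bookkeeping)] -/
theorem admissible_shadow₁₃CoPR (θ : Stage13RParams F N) (h : θ.Provisos₁₃CoPR F N) {γ' : ℝ} (hθ : θ.Admissible F N) (hγ' : 0 < γ') :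
    (shadow₅OfRecord₁₃CoPR F N θ h γ').Admissible :=
  ⟨hθ.1.1.1.1.1.1, hγ'⟩

/-- (v1.6 `R` · Co · bg-FREE PROVISO CORE) The shadow's upstream block IS the Stage-13 view's (`rfl`). [cite: Balaban1985UV3, Thm 1 p.257 (bookkeeping)] -/
theorem upOfRecord₅C_shadow₁₃CoPR (θ : Stage13RParams F N) (h : θ.Provisos₁₃CoPR F N) (γ' : ℝ) (P : B12.RunParams) :
    upOfRecord₅C F N (shadow₅OfRecord₁₃CoPR F N θ h γ') P = upOfRecord₅C F N (θ.toStage5₁₃CoPR F N) P := rfl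

/-- (v1.6 `R` · Co · bg-FREE PROVISO CORE) The shadow datum has the SAME CONSTRUCTION as the Stage-13 datum. [cite: Balaban1989LargeFieldII, Thm 1 + (0.1) pp.355–356 (bookkeeping)] -/
theorem datumOfRecord₅_shadow₁₃CoPR_C (θ : Stage13RParams F N) (h : θ.Provisos₁₃CoPR F N) (γ' : ℝ) :
    (datumOfRecord₅ F N (shadow₅OfRecord₁₃CoPR F N θ h γ')).C = (datumOfRecord₁₃CoPR F N θ h).C :=
  datumOfRecord_C_eq_datumOfTower F N (machineOfRecord₅ F N (shadow₅OfRecord₁₃CoPR F N θ h γ')) (towerOfRecord₁₃CoPR F N θ h) (fun _ _ => rfl)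

/-- (v1.6 `R` · Co · bg-FREE PROVISO CORE) … the same densities. [cite: Balaban1988Convergent, (0.2) p.244 (bookkeeping)] -/
theorem dens_datumOfRecord₅_shadow₁₃CoPR (θ : Stage13RParams F N) (h : θ.Provisos₁₃CoPR F N) (γ' : ℝ) (K : ℕ) (g₀ : ℝ) (k : ℕ) :
    (datumOfRecord₅ F N (shadow₅OfRecord₁₃CoPR F N θ h γ')).dens K g₀ k = (datumOfRecord₁₃CoPR F N θ h).dens K g₀ k :=
  dens_datumOfRecord_eq_datumOfTower F N (machineOfRecord₅ F N (shadow₅OfRecord₁₃CoPR F N θ h γ')) (towerOfRecord₁₃CoPR F N θ h) (fun _ _ => rfl) K g₀ k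

/-- (v1.6 `R` · Co · bg-FREE PROVISO CORE) … the same β-functions (`rfl`). [cite: Balaban1987RG1, (1.22) p.264 (bookkeeping)] -/
theorem βfun_datumOfRecord₅_shadow₁₃CoPR (θ : Stage13RParams F N) (h : θ.Provisos₁₃CoPR F N) (γ' : ℝ) :
    (datumOfRecord₅ F N (shadow₅OfRecord₁₃CoPR F N θ h γ')).βfun = (datumOfRecord₁₃CoPR F N θ h).βfun := rfl

/-- (v1.6 `R` · Co · bg-FREE PROVISO CORE) … and the same averaging maps (`rfl`). [cite: Balaban1987RG1, (0.4) p.253 (bookkeeping)] -/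
theorem av_datumOfRecord₅_shadow₁₃CoPR (θ : Stage13RParams F N) (h : θ.Provisos₁₃CoPR F N) (γ' : ℝ) :
    (datumOfRecord₅ F N (shadow₅OfRecord₁₃CoPR F N θ h γ')).av = (datumOfRecord₁₃CoPR F N θ h).av := rfl

/-- (v1.6 `R` · Co · bg-FREE PROVISO CORE) **A STAGE-13 WORLD IS A STAGE-5 RECORD AT THE SHADOW DATUM**. [cite: Balaban1989LargeFieldII, Thm 1 + (0.1) pp.355–356 (bookkeeping)] -/
theorem isRecordOfRecord₅C_shadow₁₃CoPR (θ : Stage13RParams F N) (h : θ.Provisos₁₃CoPR F N) (hθ : θ.Admissible F N) (w : WorldP)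
    (hC : w.C = (datumOfRecord₁₃CoPR F N θ h).C) (hγ : 0 < w.γ) (hL : w.L = (θ.L : ℝ))
    (hup : ∀ P, w.up P = upOfRecord₅C F N (θ.toStage5₁₃CoPR F N) P) :
    IsRecordOfRecord₅C F N (datumOfRecord₅ F N (shadow₅OfRecord₁₃CoPR F N θ h w.γ)) w :=
  isRecordOfRecord₅C_shadow F N (shadow₅OfRecord₁₃CoPR F N θ h w.γ) (admissible_shadow₁₃CoPR F N θ h hθ hγ) (towerOfRecord₁₃CoPR F N θ h)
    (fun _ _ => rfl) w hC rfl hL hup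

variable {F N}

/-- (v1.6 `R` · Co · bg-FREE PROVISO CORE) **REFINEMENT `IsRecordOfRecord₁₃CCoPR → IsRecordOfRecord₅C` AT THE SHADOW**: every Stage-13 record's world is a Stage-5 record at a datum with THE SAME construction,
densities, β-functions and averaging maps. [cite: Balaban1989LargeFieldII, Thm 1 + (0.1) pp.355–356 (bookkeeping)] -/
theorem exists_isRecordOfRecord₅C_of_isRecordOfRecord₁₃CCoPR {D : FiniteEpsData F (SU N)} {w : WorldP} (h : IsRecordOfRecord₁₃CCoPR F N D w) :
    ∃ D₅ : FiniteEpsData F (SU N), IsRecordOfRecord₅C F N D₅ w ∧ D₅.C = D.C ∧ (∀ K g₀ k, D₅.dens K g₀ k = D.dens K g₀ k) ∧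
      D₅.βfun = D.βfun ∧ D₅.av = D.av := by
  obtain ⟨θ, hP, hθ, rfl, hC, ⟨hγ0, -⟩, hL, hup⟩ := h
  exact ⟨_, isRecordOfRecord₅C_shadow₁₃CoPR F N θ hP hθ w hC hγ0 hL hup, datumOfRecord₅_shadow₁₃CoPR_C F N θ hP w.γ,
    dens_datumOfRecord₅_shadow₁₃CoPR F N θ hP w.γ, rfl, rfl⟩

/-- (v1.6 `R` · Co · bg-FREE PROVISO CORE) **TRANSFER**: every node statement established over the Stage-5 record predicate in the `AtRecord` shape holds at every run of every Stage-13 record's world.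
[cite: Balaban1989LargeFieldII, Thm 1 p.355 (bookkeeping)] -/
theorem atWorld_of_isRecordOfRecord₁₃CCoPR {X : Dag.Leaves → Prop}
    (h₅ : ∀ (D : FiniteEpsData F (SU N)) (w : WorldP), IsRecordOfRecord₅C F N D w → ∀ P : B12.RunParams, X (leavesP w P))
    {D : FiniteEpsData F (SU N)} {w : WorldP} (h : IsRecordOfRecord₁₃CCoPR F N D w) (P : B12.RunParams) : X (leavesP w P) := by
  obtain ⟨D₅, h5, -⟩ := exists_isRecordOfRecord₅C_of_isRecordOfRecord₁₃CCoPR h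
  exact h₅ D₅ w h5 P

section TransferredCoPR

variable {D : FiniteEpsData F (SU N)} {w : WorldP}

/-- (v1.6 `R` · Co · bg-FREE PROVISO CORE) Instance · GUARDED (0.20) at every Stage-13 record. [cite: Balaban1987RG1, (0.20) p.256] -/
theorem rgFlow_of_smallCouplings_of_isRecordOfRecord₁₃CCoPR (h : IsRecordOfRecord₁₃CCoPR F N D w) (P : B12.RunParams)
    (hsc : (leavesP w P).smallCouplings) : (leavesP w P).rgFlow := by
  obtain ⟨D₅, h5, -⟩ := exists_isRecordOfRecord₅C_of_isRecordOfRecord₁₃CCoPR h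
  exact rgFlow_of_smallCouplings_of_isRecordOfRecord₅C h5 P hsc

/-- (v1.6 `R` · Co · bg-FREE PROVISO CORE) Instance · N01 `Dag.B4_main` at every run of every Stage-13 record. [cite: Balaban1983RegularityDecay, Theorem p.573 (kernel version, transferred)] -/
theorem b4_main_of_isRecordOfRecord₁₃CCoPR (h : IsRecordOfRecord₁₃CCoPR F N D w) (P : B12.RunParams) : Dag.B4_main (leavesP w P) :=
  atWorld_of_isRecordOfRecord₁₃CCoPR (fun _ _ h5 P => b4_main_of_isRecordOfRecord₅C h5 P) h P

/-- (v1.6 `R` · Co · bg-FREE PROVISO CORE) Instance · N02 `Dag.B5_main` at every run of every Stage-13 record. [cite: Balaban1984PropagatorsI, Props. 1.1–1.2 pp.33–36 (kernel versions, transferred)] -/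
theorem b5_main_of_isRecordOfRecord₁₃CCoPR (h : IsRecordOfRecord₁₃CCoPR F N D w) (P : B12.RunParams) : Dag.B5_main (leavesP w P) :=
  atWorld_of_isRecordOfRecord₁₃CCoPR (fun _ _ h5 P => b5_main_of_isRecordOfRecord₅C h5 P) h P

/-- (v1.6 `R` · Co · bg-FREE PROVISO CORE) Instance · N04 `Dag.B7_main` at every run of every Stage-13 record. [cite: Balaban1985Averaging, Props. 1–10 pp.26–50 (kernel version, transferred)] -/
theorem b7_main_of_isRecordOfRecord₁₃CCoPR (h : IsRecordOfRecord₁₃CCoPR F N D w) (P : B12.RunParams) : Dag.B7_main (leavesP w P) :=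
  atWorld_of_isRecordOfRecord₁₃CCoPR (fun _ _ h5 P => b7_main_of_isRecordOfRecord₅C h5 P) h P

/-- (v1.6 `R` · Co · bg-FREE PROVISO CORE) Instance · the END headline at a Stage-13 record needs NO `rgFlow` binder. [cite: Balaban1989LargeFieldII, Thm 1 p.355 + p.391] -/
theorem endStatementBPrinted_of_isRecordOfRecord₁₃CCoPR_of_nodes (h : IsRecordOfRecord₁₃CCoPR F N D w) {γ₀ : ℝ} (hγ₀ : w.γ ≤ γ₀)
    (hnodes : ∀ P, Nodes (leavesP w P)) (hβ : BetaBoundsInInterval w.C.toB12 γ₀ w.b w.βup) :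
    B16.EndStatementBPrinted D.C := by
  obtain ⟨D₅, h5, hC5, -⟩ := exists_isRecordOfRecord₅C_of_isRecordOfRecord₁₃CCoPR h
  rw [← hC5]
  exact endStatementBPrinted_of_isRecordOfRecord₅C_of_nodes h5 hγ₀ hnodes hβ

end TransferredCoPR

section BetaLayerCoPR

variable {D : FiniteEpsData F (SU N)} {w : WorldP}

variable (F N) in
/-- (v1.6 `R` · Co · bg-FREE PROVISO CORE) FACE `A_{k+1}`: the core's effective action at step `k+1` IS (0.19)'s `log(𝐍_k⁻¹ · (T_k(χ_k e^{−GF∕g_k²+A_k}))(V))` with `T_k := TcanOfRecord`,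
`χ_k := chiFixed29 θ.ν θ.ε₂₉` along the ₁₃ history (`rfl`) — the VALUES this record's β reads: values of a VERSION, canonical by construction, equal to
print's point values wherever the transform's a.e.-class has a continuous representative near the point (`betaInput_eqOn_of_continuousOn₁₃`) and
nowhere asserted to be print's elsewhere. [cite: Balaban1987RG1, (0.19) p.255, p.259 (bookkeeping)] -/
theorem effAction_succ_stage13CoPR (θ : Stage13RParams F N) (h : θ.Provisos₁₃CoPR F N) (p : B12.RunParams) (k : ℕ) (V : GaugeField (F.P p.K) (k + 1) (SU N)) :
    ((datumOfRecord₁₃CoPR F N θ h).C p).effAction (k + 1) V =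
      Real.log ((normConstHT F N (TcanOfRecord F N) (chiFixed29 F N θ.ν θ.ε₂₉) p.K (gOfRecord₁₃ F N θ.toStage13Params p) k)⁻¹ *
        TcanOfRecord F N p.K k (integrand (chiFixed29 F N θ.ν θ.ε₂₉ p.K (gOfRecord₁₃ F N θ.toStage13Params p) k) (gfOfRecord F N p.K k)
          (gOfRecord₁₃ F N θ.toStage13Params p k)
          (effActionHT F N (TcanOfRecord F N) (chiFixed29 F N θ.ν θ.ε₂₉) p.K (gOfRecord₁₃ F N θ.toStage13Params p) k)) V) := rfl

/-- (v1.6 `R` · Co · bg-FREE PROVISO CORE) **A Stage-13 record's β IS the χ-generic β at the canonical-version transport and the (2.9) species at a positive threshold `ε₂₉`** (elimination face for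
β-readers: NODE O, N24, N26). [cite: Balaban1987RG1, (1.20)–(1.22) p.264, (2.9) p.266, (0.13) p.254 (bookkeeping)] -/
theorem exists_beta_of_isRecordOfRecord₁₃CCoPR (h : IsRecordOfRecord₁₃CCoPR F N D w) :
    ∃ (θ : Stage13RParams F N) (hP : θ.Provisos₁₃CoPR F N), θ.Admissible F N ∧ D = datumOfRecord₁₃CoPR F N θ hP ∧
      D.βfun = betaOfRecord₈Tχ F N (TcanOfRecord F N) (chiFixed29 F N θ.ν θ.ε₂₉) θ.toStage8Params ∧ 0 < θ.ε₂₉ := by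
  obtain ⟨θ, hP, hθ, hD, -⟩ := h
  exact ⟨θ, hP, hθ, hD, hD ▸ rfl, hθ.2⟩

end BetaLayerCoPR

end CoreRecordCoPR

/-! ## §R1. THE RUN-BLIND EMBEDDING OF THE v1.5 `CoP` RECORD (plan g69 IMPACT-169-ADDENDUM Q4; def-T probe P3′ promoted to the tree): every v1.5 parameter
`θ : Stage13Params` IS a v1.6 parameter `Stage13RParams.ofRunBlind θ := ⟨θ, fun p => θ.Zt p.K⟩` whose run-indexed slot reads the run-blind one at the
run's torus; at it the run's weights, the core, the Stage-5 view, the datum and the core record family of THIS file ARE the v1.5 ones (`rfl`), the bg-free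
provisos `Provisos₁₃Core` GIVE `Provisos₁₃CoPR` and 12b's `ZtUnity` GIVES `ZrUnity`.  One-way: a v1.6 parameter need not be run-blind (FINDING №8 is the point). -/

section RunBlindCoPR

/-- **THE RUN-BLIND EMBEDDING** (v1.6 `R`; plan g69 Q4): the v1.5 Stage-13 parameter `θ` with the run-indexed residual 𝐓-weight slot FILLED BY ITS RUN-BLIND ONE at the
run's torus, `Zr p := θ.Zt p.K`.  Every object of record of the v1.5 `CoP` edition is the corresponding v1.6 `CoPR` object at `ofRunBlind θ` (the `_ofRunBlind`
lemmas below, all `rfl`); the converse embedding does not exist (a run-indexed residual is in general NOT constant along the runs on one torus — print's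
`ζ(Ω^c_{k+1})` reads the run, [III] (1.11) p.248, (2.4) p.255, p.267). [cite: Balaban1988Convergent, (1.11) p.248, (2.4) p.255, (3.16)–(3.20) pp.268–269, p.267] -/
def Stage13RParams.ofRunBlind (θ : Stage13Params F N) : Stage13RParams F N :=
  ⟨θ, fun p => θ.Zt p.K⟩

/-- The embedding forgets to the parameter it came from (`rfl`). [cite: Balaban1988Convergent, (3.16) p.268 (bookkeeping)] -/
theorem Stage13RParams.ofRunBlind_toStage13Params (θ : Stage13Params F N) : (Stage13RParams.ofRunBlind F N θ).toStage13Params = θ := rfl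

/-- The run-indexed slot of the embedding IS the run-blind slot at the run's torus (`rfl`). [cite: Balaban1988Convergent, (3.16) p.268 (bookkeeping)] -/
theorem Stage13RParams.ofRunBlind_Zr (θ : Stage13Params F N) (p : B12.RunParams) : (Stage13RParams.ofRunBlind F N θ).Zr p = θ.Zt p.K := rfl

/-- **P3′ OF RECORD**: the v1.5 𝐓-weights of the run `WtOfRecord₁₃P θ p` ARE the v1.6 weights `WtOfRecord₁₃R` at the run-blind embedding (`rfl`) — the v1.5 record is
the run-blind SPECIAL CASE of the run-indexed builder. [cite: Balaban1988Convergent, (2.21) p.258, (3.16) p.268 (bookkeeping)] -/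
theorem WtOfRecord₁₃R_ofRunBlind (θ : Stage13Params F N) (p : B12.RunParams) :
    WtOfRecord₁₃R F N (Stage13RParams.ofRunBlind F N θ) p = WtOfRecord₁₃P F N θ p := rfl

variable {F N} in
/-- 12b's per-torus partition of unity `ZtUnity` GIVES the per-run guard `ZrUnity` at the run-blind embedding. [cite: Balaban1988Convergent, (3.16)–(3.20) pp.268–269 (bookkeeping)] -/
theorem Stage12Params.ZtUnity.ofRunBlind {θ : Stage13Params F N} (hu : θ.ZtUnity F N) : (Stage13RParams.ofRunBlind F N θ).ZrUnity F N :=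
  fun p j ω => hu p.K j ω

variable {F N} in
/-- Admissibility is read through `toStage13Params`: at the run-blind embedding it IS v1.2's (`Iff.rfl`). [cite: Balaban1988Convergent, (2.9) p.256 (bookkeeping)] -/
theorem Stage13RParams.admissible_ofRunBlind_iff {θ : Stage13Params F N} : (Stage13RParams.ofRunBlind F N θ).Admissible F N ↔ θ.Admissible F N := Iff.rfl

variable {F N} in
/-- The slot non-degeneracy guard is read through `toStage13Params`: at the run-blind embedding it IS v1.2's (`Iff.rfl`). [cite: Balaban1988Convergent, (2.18) p.257 (bookkeeping)] -/
theorem Stage13RParams.slotsNondegenerate₁₃_ofRunBlind_iff {θ : Stage13Params F N} :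
    (Stage13RParams.ofRunBlind F N θ).SlotsNondegenerate₁₃ F N ↔ θ.SlotsNondegenerate₁₃ F N := Iff.rfl

variable {F N} in
/-- **v1.2's bg-free proviso core GIVES the v1.6 core at the run-blind embedding** (rows verbatim; `zrLaws p := ztLaws p.K`, `zrLocal p := ztLocal p.K`).
[cite: Balaban1988Convergent, (2.21) p.258, (3.16) p.268 (bookkeeping)] -/
theorem Stage13Params.Provisos₁₃Core.ofRunBlind {θ : Stage13Params F N} (h : θ.Provisos₁₃Core F N) :
    (Stage13RParams.ofRunBlind F N θ).Provisos₁₃CoPR F N where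
  intPiece := h.intPiece
  measω := h.measω
  measChi := h.measChi
  zetaUnity := h.zetaUnity
  zetaAbs := h.zetaAbs
  rstep := fun p k _ hk => h.rstep p k hk
  rzLaws := h.rzLaws
  zrLaws := fun p => h.ztLaws p.K
  zrLocal := fun p => h.ztLocal p.K

/-- The v1.6 core at the run-blind embedding IS the v1.5 core (`rfl`). [cite: Balaban1987RG1, (0.13) p.254 (bookkeeping)] -/
theorem coreOfRecord₁₃CoPR_ofRunBlind (θ : Stage13Params F N) :
    coreOfRecord₁₃CoPR F N (Stage13RParams.ofRunBlind F N θ) = coreOfRecord₁₃CoP F N θ := rfl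

/-- The v1.6 Stage-5 view at the run-blind embedding IS the v1.5 one (`rfl`). [cite: Balaban1988Convergent, (2.18) p.257 (bookkeeping)] -/
theorem Stage13RParams.toStage5₁₃CoPR_ofRunBlind (θ : Stage13Params F N) :
    (Stage13RParams.ofRunBlind F N θ).toStage5₁₃CoPR F N = θ.toStage5₁₃CoP F N := rfl

variable {F N} in
/-- **P3′ AT DATUM LEVEL** (plan g69 Q4): the v1.6 core datum at the run-blind embedding IS the v1.5 core datum (`rfl`). [cite: Balaban1987RG1, (0.4) p.253 (bookkeeping)] -/
theorem datumOfRecord₁₃CoPR_ofRunBlind {θ : Stage13Params F N} (h : θ.Provisos₁₃Core F N) :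
    datumOfRecord₁₃CoPR F N (Stage13RParams.ofRunBlind F N θ) h.ofRunBlind = datumOfRecord₁₃CoP F N θ h := rfl

variable {F N} in
/-- **EVERY v1.5 Co CORE RECORD IS A v1.6 CORE RECORD** (same datum, same world; along `Stage13RParams.ofRunBlind`).  One-way. [cite: Balaban1989LargeFieldII, Thm 1 + (0.1) pp.355–356 (bookkeeping)] -/
theorem IsRecordOfRecord₁₃CCoPR.ofCoP {D : FiniteEpsData F (SU N)} {w : WorldP} (h : IsRecordOfRecord₁₃CCoP F N D w) :
    IsRecordOfRecord₁₃CCoPR F N D w := by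
  obtain ⟨θ, hP, hθ, hD, hC, hγ, hL, hup⟩ := h
  exact ⟨Stage13RParams.ofRunBlind F N θ, hP.ofRunBlind, hθ, hD.trans (datumOfRecord₁₃CoPR_ofRunBlind hP).symm, hC, hγ, hL,
    fun P => (hup P).trans (congrArg (fun ϑ => upOfRecord₅C F N ϑ P) (Stage13RParams.toStage5₁₃CoPR_ofRunBlind F N θ).symm)⟩

end RunBlindCoPR

end Literature.MathematicalPhysics.QuantumFieldTheory.Balaban1983to89.Node00

end
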